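import Literature.Analysis.FluidPDE.WaveKinetic
import Mathlib.Analysis.InnerProductSpace.Projection.Reflection
import Mathlib.MeasureTheory.Measure.Haar.Unique
import Mathlib.Analysis.SpecialFunctions.JapaneseBracket
import Mathlib.MeasureTheory.Function.SpecialFunctions.Inner
import Mathlib.MeasureTheory.Constructions.HaarToSphere

/-!
# Conservation of energy for the wave kinetic equation — proofs

(trunk: FluidKinetic / T-KINETIC; sibling proof file of `Literature.Analysis.FluidPDE.WaveKinetic`,
discharging its named fact `Literature.Analysis.FluidPDE.WaveKinetic.IsWKESolutionOn.energy_conserved`.)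

Main result: `Literature.WaveKinetic.IsWKESolutionOn.energy_conserved_holds :
IsWKESolutionOn.energy_conserved`, i.e. for a classical solution `n` of the four-wave kinetic
equation `∂ₜ n = 𝒦(n)` on `[0, T)` (`IsWKESolutionOn`) on a Euclidean space `E` of dimension `≥ 3`,
with `n t` measurable and `|n(t, k)| ≤ C (1 + ‖k‖)^{-s}`, `s > dim E + 2` (`HasUniformDecayOn`),
the energy `∫ ‖k‖² n(t, k) dk` equals its initial value for all `t ∈ [0, T)`.

## The printed argument and what this file adds

Nazarenko, *Wave Turbulence* (LNP 825), §8.1.3, pp. 165–166, eq. (8.18)–(8.21): for a density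
`ρ_k` and `Φ = ∫ ρ_k n_k dk`, differentiating under the integral and changing variables
`k ⇄ k₃`, `k ⇄ k₁`, `k ⇄ k₂` in the second to fourth terms of the kinetic integrand gives
`Φ̇ = ∫ (ρ_k + ρ₃ − ρ₁ − ρ₂) |W|² δ δ(ω) n₁ n₂ n₃ n_k`, which vanishes when
`ρ_k + ρ₃ − ρ₁ − ρ₂ = 0` on the resonant manifold ((8.19)–(8.21)); the energy is the case
`ρ_k = ω_k = |k|²`. In the convention of `WaveKinetic.collision` (`k₁ − k₂ + k₃ = k`,
`k₁ = k + a`, `k₂ = k + a + b`, `k₃ = k + b`, `b ⊥ a`) the invariance condition reads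
`|k|² − |k₁|² + |k₂|² − |k₃|² = 2⟨a, b⟩ = 0`.

The file makes this formal computation rigorous under the hypotheses of the named fact
(only `dim E ≥ 2` is actually used):

* §A a measurable trivialisation of the hyperplane measures: the Householder reflection
  `hhR e a = reflection (ℝ ∙ (‖a‖⁻¹ • a − e))ᗮ` maps a fixed hyperplane `(ℝ ∙ e)ᗮ` isometrically
  onto `(ℝ ∙ a)ᗮ` (`hhT`, measure preserving), jointly measurably in `(a, c)`; all hyperplane
  integrals are transferred to the fixed frame (`integral_orth_eq_frame`, `collision_frame`).
* §B envelope integrals: `J s x = (1 + ‖x‖)^{-s}`, local integrability of `(2‖a‖)⁻¹` in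
  dimension `≥ 2` (**L0**, via `integrableOn_fun_norm_addHaar`), the uniform hyperplane bound
  **L1** and the uniform singular-weight bound **L2**.
* §C the resonant lower integral `N e F = ∫⁻ k ∫⁻ a ∫⁻ c (2‖a‖)⁻¹ F k a (hhR e a c)`, Tonelli, and its
  invariance under `(k, a, b) ↦ (k + a + b, −a, −b)`, i.e. `(k, k₁, k₂, k₃) ↦ (k₂, k₃, k, k₁)`
  (`N_symm`); §C3 finiteness of `N (wt · env)` for the total weight `wt = Σ ‖kᵢ‖²` and the
  envelope `env` of `|cubicForm|`, for `s > dim E + 2` (direct bounds for the loss-type products,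
  the symmetry for the gain-type ones).
* §D Fubini and the four changes of variables (`gfun_one/two/three`, `Inest_zero_*`), giving
  `∫ ‖k‖² 𝒦(n)(k) dk = 0` (`integral_normSq_mul_collision`).
* §E the time step: `t ↦ ∫ ‖k‖² n(t, k) dk` is continuous on `[0, T)` (dominated convergence) and
  has vanishing right derivative (mean value inequality for right derivatives in `k`-pointwise
  form, dominated convergence along `𝓝[>] t` with the bound `‖k‖² C³ Genv k`), hence is constant
  (`constant_of_has_deriv_right_zero`).

## Design notes

* At `a = 0` the weight `(2‖a‖)⁻¹` is the junk value `0`, so every frame identity holds pointwise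
  in `a` and no null-set bookkeeping is needed there.
* Only the symmetry `(k, a, b) ↦ (k + a + b, −a, −b)` of the resonant measure is used at the
  Tonelli level; the `a ↔ b` symmetry of `δ(⟨a, b⟩) da db` is never needed.
* All definitions in this file (`hhR`, `hhT`, `J`, `wE`, `CE`, `N`, `Meas3`, `T013`, `T012`, `wt`,
  `env`, `FinHyp`, `jr`, `Decays`, `wgt`, `Ψ`, `gfun`, `Inest`, `Genv`) are proof devices, not
  library notions; they live in the sub-namespace `Literature.WaveKinetic.EnergyConservation`.

## References

* S. Nazarenko, *Wave Turbulence*, Lecture Notes in Physics 825, Springer 2011: §8.1.3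
  (conservation laws of four-wave systems), eq. (8.18)–(8.21); eq. (6.81) (the kinetic equation).
* Y. Deng, Z. Hani, *On the derivation of the wave kinetic equation for NLS*, Forum Math. Pi 9
  (2021) e6, §1 (the WKE in the NLS normalisation used by `WaveKinetic.collision`).
-/

open MeasureTheory Set Topology Filter
open scoped InnerProductSpace ENNReal NNReal

namespace Literature.Analysis.FluidPDE
noncomputable section
namespace WaveKinetic

variable {E : Type*} [NormedAddCommGroup E] [InnerProductSpace ℝ E] [FiniteDimensional ℝ E]
  [MeasurableSpace E] [BorelSpace E]

namespace EnergyConservation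

/-! ### A. A measurable Householder frame for the hyperplanes `(ℝ ∙ a)ᗮ` -/

/-- The Householder reflection of `E` exchanging the unit vector `e` and `‖a‖⁻¹ • a`
(reflection in the hyperplane orthogonal to `‖a‖⁻¹ • a - e`). [folklore] -/
def hhR (e a : E) : E ≃ₗᵢ[ℝ] E := ((ℝ ∙ (‖a‖⁻¹ • a - e))ᗮ).reflection

omit [FiniteDimensional ℝ E] [MeasurableSpace E] [BorelSpace E] in
/-- Explicit Householder formula `hhR e a v = v - 2 (⟪u, v⟫ / ‖u‖²) u` with `u = ‖a‖⁻¹ • a - e`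
(junk-free: `0/0 = 0` gives the identity when `u = 0`). [folklore] -/
theorem hhR_apply (e a v : E) : hhR e a v =
    -((2 : ℝ) • (⟪‖a‖⁻¹ • a - e, v⟫_ℝ / ‖‖a‖⁻¹ • a - e‖ ^ 2) • (‖a‖⁻¹ • a - e) - v) := by
  unfold hhR
  rw [Submodule.reflection_orthogonal_apply, Submodule.reflection_singleton_apply]
  simp [two_smul]

/-- The Householder frame `(a, v) ↦ hhR e a v` is jointly (Borel) measurable. [folklore] -/
theorem measurable_hhR (e : E) : Measurable (fun p : E × E => hhR e p.1 p.2) := by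
  have : (fun p : E × E => hhR e p.1 p.2) = fun p : E × E =>
      -((2 : ℝ) • (⟪‖p.1‖⁻¹ • p.1 - e, p.2⟫_ℝ / ‖‖p.1‖⁻¹ • p.1 - e‖ ^ 2) • (‖p.1‖⁻¹ • p.1 - e)
        - p.2) := by
    funext p; exact hhR_apply e p.1 p.2
  rw [this]
  fun_prop

omit [FiniteDimensional ℝ E] [MeasurableSpace E] [BorelSpace E] in
/-- `hhR e a` is an involution. [folklore] -/
@[simp] theorem hhR_hhR (e a v : E) : hhR e a (hhR e a v) = v :=
  Submodule.reflection_reflection _ _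

omit [FiniteDimensional ℝ E] [MeasurableSpace E] [BorelSpace E] in
/-- `hhR e a` maps the unit vector `‖a‖⁻¹ • a` to `e` (Mathlib's `reflection_sub`). [folklore] -/
theorem hhR_unit {e a : E} (he : ‖e‖ = 1) (ha : a ≠ 0) : hhR e a (‖a‖⁻¹ • a) = e :=
  Submodule.reflection_sub (by simp [norm_smul, he, ha])

omit [FiniteDimensional ℝ E] [MeasurableSpace E] [BorelSpace E] in
/-- `hhR e a` maps `e` to the unit vector `‖a‖⁻¹ • a`. [folklore] -/
theorem hhR_e {e a : E} (he : ‖e‖ = 1) (ha : a ≠ 0) : hhR e a e = ‖a‖⁻¹ • a := by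
  have h := congrArg (hhR e a) (hhR_unit he ha)
  rw [hhR_hhR] at h
  exact h.symm

omit [FiniteDimensional ℝ E] [MeasurableSpace E] [BorelSpace E] in
/-- `hhR e a` maps `e^⊥` into `a^⊥`: `⟪a, hhR e a c⟫ = 0` for `c ⊥ e`. [folklore] -/
theorem inner_hhR_of_mem {e a : E} (he : ‖e‖ = 1) (ha : a ≠ 0) {c : E} (hc : c ∈ (ℝ ∙ e)ᗮ) :
    ⟪a, hhR e a c⟫_ℝ = 0 := by
  have h1 : ‖a‖ • hhR e a e = a := by
    rw [hhR_e he ha, smul_smul, mul_inv_cancel₀ (norm_ne_zero_iff.mpr ha), one_smul]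
  rw [Submodule.mem_orthogonal_singleton_iff_inner_right] at hc
  calc ⟪a, hhR e a c⟫_ℝ = ⟪‖a‖ • hhR e a e, hhR e a c⟫_ℝ := by rw [h1]
    _ = ‖a‖ * ⟪e, c⟫_ℝ := by rw [real_inner_smul_left, LinearIsometryEquiv.inner_map_map]
    _ = 0 := by rw [hc, mul_zero]

omit [FiniteDimensional ℝ E] [MeasurableSpace E] [BorelSpace E] in
/-- `hhR e a` maps `(ℝ ∙ e)ᗮ` into `(ℝ ∙ a)ᗮ`. [folklore] -/
theorem hhR_mem {e a : E} (he : ‖e‖ = 1) (ha : a ≠ 0) {c : E} (hc : c ∈ (ℝ ∙ e)ᗮ) :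
    hhR e a c ∈ (ℝ ∙ a)ᗮ :=
  (Submodule.mem_orthogonal_singleton_iff_inner_right).mpr (inner_hhR_of_mem he ha hc)

omit [FiniteDimensional ℝ E] [MeasurableSpace E] [BorelSpace E] in
/-- `hhR e a` maps `(ℝ ∙ a)ᗮ` into `(ℝ ∙ e)ᗮ`. [folklore] -/
theorem hhR_mem' {e a : E} (he : ‖e‖ = 1) (ha : a ≠ 0) {b : E} (hb : b ∈ (ℝ ∙ a)ᗮ) :
    hhR e a b ∈ (ℝ ∙ e)ᗮ := by
  rw [Submodule.mem_orthogonal_singleton_iff_inner_right] at hb ⊢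
  calc ⟪e, hhR e a b⟫_ℝ = ⟪hhR e a (hhR e a e), hhR e a b⟫_ℝ := by rw [hhR_hhR]
    _ = ⟪hhR e a e, b⟫_ℝ := LinearIsometryEquiv.inner_map_map _ _ _
    _ = ‖a‖⁻¹ * ⟪a, b⟫_ℝ := by rw [hhR_e he ha, real_inner_smul_left]
    _ = 0 := by rw [hb, mul_zero]

/-- The Householder frame: `hhR e a` restricts to a linear isometry of `(ℝ ∙ e)ᗮ` onto
`(ℝ ∙ a)ᗮ` (for a unit vector `e` and `a ≠ 0`). [folklore] -/
def hhT {e a : E} (he : ‖e‖ = 1) (ha : a ≠ 0) : ↥(ℝ ∙ e)ᗮ ≃ₗᵢ[ℝ] ↥(ℝ ∙ a)ᗮ where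
  toFun c := ⟨hhR e a c, hhR_mem he ha c.2⟩
  invFun b := ⟨hhR e a b, hhR_mem' he ha b.2⟩
  map_add' x y := by ext; simp
  map_smul' r x := by ext; simp
  left_inv c := by ext; simp
  right_inv b := by ext; simp
  norm_map' c := by
    simp only [LinearEquiv.coe_mk, LinearMap.coe_mk, AddHom.coe_mk]
    exact (hhR e a).norm_map c

omit [FiniteDimensional ℝ E] [MeasurableSpace E] [BorelSpace E] in
/-- The frame isometry `hhT` acts as `hhR e a` on vectors. [folklore] -/
@[simp] theorem coe_hhT {e a : E} (he : ‖e‖ = 1) (ha : a ≠ 0) (c : ↥(ℝ ∙ e)ᗮ) :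
    (hhT he ha c : E) = hhR e a c := rfl

/-- Transfer of hyperplane integrals to the fixed frame `(ℝ ∙ e)ᗮ`. [folklore] -/
theorem integral_orth_eq_frame {G : Type*} [NormedAddCommGroup G] [NormedSpace ℝ G] {e a : E}
    (he : ‖e‖ = 1) (ha : a ≠ 0) (g : E → G) :
    ∫ b : ↥(ℝ ∙ a)ᗮ, g b = ∫ c : ↥(ℝ ∙ e)ᗮ, g (hhR e a c) := by
  rw [← (hhT he ha).measurePreserving.integral_comp
    (hhT he ha).toMeasurableEquiv.measurableEmbedding]
  rfl

/-- Transfer of hyperplane lower integrals to the fixed frame `(ℝ ∙ e)ᗮ` (the frame isometry is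
measure preserving). [folklore] -/
theorem lintegral_orth_eq_frame {e a : E} (he : ‖e‖ = 1) (ha : a ≠ 0) (g : E → ℝ≥0∞) :
    ∫⁻ b : ↥(ℝ ∙ a)ᗮ, g b = ∫⁻ c : ↥(ℝ ∙ e)ᗮ, g (hhR e a c) := by
  rw [← (hhT he ha).measurePreserving.lintegral_comp_emb
    (hhT he ha).toMeasurableEquiv.measurableEmbedding]
  rfl

omit [FiniteDimensional ℝ E] [MeasurableSpace E] [BorelSpace E] in
/-- `ℝ ∙ (-a) = ℝ ∙ a`. [folklore] -/
theorem span_neg_eq (a : E) : (ℝ ∙ (-a)) = (ℝ ∙ a) := by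
  simpa using Submodule.span_neg ({a} : Set E)

/-- Bochner integrals over (propositionally) equal submodules agree. [folklore] -/
theorem integral_submodule_congr {G : Type*} [NormedAddCommGroup G] [NormedSpace ℝ G]
    {K K' : Submodule ℝ E} (h : K = K') (g : E → G) : ∫ b : ↥K, g b = ∫ b : ↥K', g b := by
  subst h; rfl

/-- Lower integrals over (propositionally) equal submodules agree. [folklore] -/
theorem lintegral_submodule_congr {K K' : Submodule ℝ E} (h : K = K') (g : E → ℝ≥0∞) :
    ∫⁻ b : ↥K, g b = ∫⁻ b : ↥K', g b := by
  subst h; rfl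

/-- `∫` over `(ℝ ∙ (-a))ᗮ` is `∫` over `(ℝ ∙ a)ᗮ`. [folklore] -/
theorem integral_orth_neg {G : Type*} [NormedAddCommGroup G] [NormedSpace ℝ G] (a : E) (g : E → G) :
    ∫ b : ↥(ℝ ∙ (-a))ᗮ, g b = ∫ b : ↥(ℝ ∙ a)ᗮ, g b :=
  integral_submodule_congr (by rw [span_neg_eq]) g

/-- `∫⁻` over `(ℝ ∙ (-a))ᗮ` is `∫⁻` over `(ℝ ∙ a)ᗮ`. [folklore] -/
theorem lintegral_orth_neg (a : E) (g : E → ℝ≥0∞) :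
    ∫⁻ b : ↥(ℝ ∙ (-a))ᗮ, g b = ∫⁻ b : ↥(ℝ ∙ a)ᗮ, g b :=
  lintegral_submodule_congr (by rw [span_neg_eq]) g

/-- `b ↦ -b` on the hyperplane. [folklore] -/
theorem integral_orth_comp_neg {G : Type*} [NormedAddCommGroup G] [NormedSpace ℝ G] (a : E) (g : E → G) :
    ∫ b : ↥(ℝ ∙ a)ᗮ, g (-(b : E)) = ∫ b : ↥(ℝ ∙ a)ᗮ, g b := by
  have := integral_neg_eq_self (fun b : ↥(ℝ ∙ a)ᗮ => g (b : E)) volume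
  simpa using this

/-- `b ↦ -b` on the hyperplane (lower integral; the hyperplane volume is negation invariant).
[folklore] -/
theorem lintegral_orth_comp_neg (a : E) (g : E → ℝ≥0∞) :
    ∫⁻ b : ↥(ℝ ∙ a)ᗮ, g (-(b : E)) = ∫⁻ b : ↥(ℝ ∙ a)ᗮ, g b := by
  have := lintegral_neg_eq_self (μ := (volume : Measure ↥(ℝ ∙ a)ᗮ)) (fun b : ↥(ℝ ∙ a)ᗮ => g (b : E))
  simpa using this


/-! ### B. Envelope integrals -/

/-- The Japanese-bracket envelope `(1 + ‖x‖) ^ (-s)` in `ℝ≥0∞`. [folklore] -/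
def J (s : ℝ) (x : E) : ℝ≥0∞ := ENNReal.ofReal ((1 + ‖x‖) ^ (-s))

/-- The weight `(2‖a‖)⁻¹` of the resonant measure in `ℝ≥0∞` (`0` at `a = 0`). [folklore] -/
def wE (a : E) : ℝ≥0∞ := ENNReal.ofReal ((2 * ‖a‖)⁻¹)

omit [InnerProductSpace ℝ E] [FiniteDimensional ℝ E] in
/-- The envelope `J s` is measurable. [folklore] -/
@[fun_prop] theorem measurable_J (s : ℝ) : Measurable (J s : E → ℝ≥0∞) := by
  unfold J; fun_prop

omit [InnerProductSpace ℝ E] [FiniteDimensional ℝ E] in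
/-- The weight `wE` is measurable. [folklore] -/
@[fun_prop] theorem measurable_wE : Measurable (wE : E → ℝ≥0∞) := by
  unfold wE; fun_prop

omit [InnerProductSpace ℝ E] [FiniteDimensional ℝ E] [MeasurableSpace E] [BorelSpace E] in
/-- The weight vanishes at `a = 0` (junk value `0⁻¹ = 0`), which makes all frame identities
pointwise in `a`. [folklore] -/
@[simp] theorem wE_zero : wE (0 : E) = 0 := by simp [wE]

omit [InnerProductSpace ℝ E] [FiniteDimensional ℝ E] [MeasurableSpace E] [BorelSpace E] in
/-- The weight is even. [folklore] -/
@[simp] theorem wE_neg (a : E) : wE (-a) = wE a := by simp [wE]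

omit [InnerProductSpace ℝ E] [FiniteDimensional ℝ E] [MeasurableSpace E] [BorelSpace E] in
/-- The weight is finite. [folklore] -/
theorem wE_ne_top (a : E) : wE a ≠ ∞ := ENNReal.ofReal_ne_top

omit [InnerProductSpace ℝ E] [FiniteDimensional ℝ E] [MeasurableSpace E] [BorelSpace E] in
/-- The envelope is finite. [folklore] -/
theorem J_ne_top (s : ℝ) (x : E) : J s x ≠ ∞ := ENNReal.ofReal_ne_top

omit [InnerProductSpace ℝ E] [FiniteDimensional ℝ E] [MeasurableSpace E] [BorelSpace E] in
/-- `(2‖a‖)⁻¹ ≤ 1` off the unit ball. [folklore] -/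
theorem wE_le_one_of {a : E} (ha : 1 ≤ ‖a‖) : wE a ≤ 1 := by
  unfold wE
  rw [← ENNReal.ofReal_one]
  exact ENNReal.ofReal_le_ofReal (inv_le_one_of_one_le₀ (by linarith))

omit [InnerProductSpace ℝ E] [FiniteDimensional ℝ E] [MeasurableSpace E] [BorelSpace E] in
/-- The envelope is radially antitone for `s ≥ 0`. [folklore] -/
theorem J_anti {s : ℝ} (hs : 0 ≤ s) {x y : E} (h : ‖x‖ ≤ ‖y‖) : J s y ≤ J s x := by
  unfold J
  apply ENNReal.ofReal_le_ofReal
  exact Real.rpow_le_rpow_of_nonpos (by positivity) (by linarith) (by linarith)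

omit [InnerProductSpace ℝ E] [FiniteDimensional ℝ E] [MeasurableSpace E] [BorelSpace E] in
/-- The envelope is at most `1` for `s ≥ 0`. [folklore] -/
theorem J_le_one {s : ℝ} (hs : 0 ≤ s) (x : E) : J s x ≤ 1 := by
  unfold J
  rw [← ENNReal.ofReal_one]
  apply ENNReal.ofReal_le_ofReal
  exact Real.rpow_le_one_of_one_le_of_nonpos (by linarith [norm_nonneg x]) (by linarith)

omit [InnerProductSpace ℝ E] [FiniteDimensional ℝ E] [MeasurableSpace E] [BorelSpace E] in
/-- Weights are absorbed by the envelope: `‖x‖² (1+‖x‖)^{-s} ≤ (1+‖x‖)^{-(s-2)}`. [folklore] -/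
theorem normSq_mul_J_le (s : ℝ) (x : E) : ENNReal.ofReal (‖x‖ ^ 2) * J s x ≤ J (s - 2) x := by
  unfold J
  rw [← ENNReal.ofReal_mul (sq_nonneg _)]
  apply ENNReal.ofReal_le_ofReal
  have h1 : 0 < 1 + ‖x‖ := by positivity
  have : (1 + ‖x‖) ^ (-(s - 2)) = (1 + ‖x‖) ^ (2 : ℝ) * (1 + ‖x‖) ^ (-s) := by
    rw [← Real.rpow_add h1]; ring_nf
  rw [this, Real.rpow_two]
  gcongr
  linarith [norm_nonneg x]

omit [InnerProductSpace ℝ E] [FiniteDimensional ℝ E] [MeasurableSpace E] [BorelSpace E] in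
/-- `‖x + y - z‖² ≤ 3 (‖x‖² + ‖y‖² + ‖z‖²)`, used to trade the fourth weight for the other three.
[folklore] -/
theorem normSq_three_le (x y z : E) :
    ENNReal.ofReal (‖x + y - z‖ ^ 2) ≤
      3 * (ENNReal.ofReal (‖x‖ ^ 2) + ENNReal.ofReal (‖y‖ ^ 2) + ENNReal.ofReal (‖z‖ ^ 2)) := by
  have h : ‖x + y - z‖ ^ 2 ≤ 3 * (‖x‖ ^ 2 + ‖y‖ ^ 2 + ‖z‖ ^ 2) := by
    have h1 : ‖x + y - z‖ ≤ ‖x‖ + ‖y‖ + ‖z‖ := by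
      calc ‖x + y - z‖ ≤ ‖x + y‖ + ‖z‖ := norm_sub_le _ _
        _ ≤ ‖x‖ + ‖y‖ + ‖z‖ := by gcongr; exact norm_add_le _ _
    have h2 : ‖x + y - z‖ ^ 2 ≤ (‖x‖ + ‖y‖ + ‖z‖) ^ 2 := by gcongr
    nlinarith [sq_nonneg (‖x‖ - ‖y‖), sq_nonneg (‖y‖ - ‖z‖), sq_nonneg (‖x‖ - ‖z‖)]
  calc ENNReal.ofReal (‖x + y - z‖ ^ 2) ≤ ENNReal.ofReal (3 * (‖x‖ ^ 2 + ‖y‖ ^ 2 + ‖z‖ ^ 2)) :=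
        ENNReal.ofReal_le_ofReal h
    _ = _ := by
        rw [ENNReal.ofReal_mul (by norm_num), ENNReal.ofReal_add (by positivity) (by positivity),
          ENNReal.ofReal_add (by positivity) (by positivity)]
        norm_num

/-- `‖a‖⁻¹` is integrable on the unit ball in dimension `≥ 2`. [folklore] -/
theorem lintegral_wE_ball_lt_top (hE : 2 ≤ Module.finrank ℝ E) :
    ∫⁻ a in Metric.ball (0 : E) 1, wE a < ∞ := by
  haveI : Nontrivial E := Module.nontrivial_of_finrank_pos (R := ℝ) (by omega)
  obtain ⟨m, hm⟩ : ∃ m, Module.finrank ℝ E = m + 2 := ⟨Module.finrank ℝ E - 2, by omega⟩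
  have hint : IntegrableOn (fun a : E => (2 * ‖a‖)⁻¹) (Metric.ball 0 1) volume := by
    rw [integrableOn_fun_norm_addHaar (E := E) volume (f := fun y : ℝ => (2 * y)⁻¹) (r := 1)]
    refine Measure.integrableOn_of_bounded (M := 1) (by simp) ?_ ?_
    · exact (Measurable.aestronglyMeasurable (by fun_prop))
    · rw [ae_restrict_iff' measurableSet_Ioo]
      refine Filter.Eventually.of_forall fun y hy => ?_
      have hm1 : Module.finrank ℝ E - 1 = m + 1 := by omega
      have hy0 : y ≠ 0 := hy.1.ne'
      have hval : y ^ (m + 1) • (2 * y)⁻¹ = y ^ m / 2 := by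
        rw [smul_eq_mul]; field_simp; ring
      rw [hm1, hval, Real.norm_eq_abs, abs_of_nonneg (by have := hy.1; positivity)]
      have : y ^ m ≤ 1 := pow_le_one₀ hy.1.le hy.2.le
      linarith
  have h2 := hint.2
  rw [hasFiniteIntegral_iff_enorm] at h2
  refine lt_of_le_of_lt (le_of_eq ?_) h2
  apply lintegral_congr
  intro a
  rw [wE, Real.enorm_eq_ofReal (by positivity)]

/-- **L1**: translates of the envelope have frame-hyperplane integral at most `∫ (1+‖c‖)^{-s}`.
[folklore] -/
theorem lintegral_J_frame_le {s : ℝ} (hs : 0 ≤ s) (e a y : E) :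
    ∫⁻ c : ↥(ℝ ∙ e)ᗮ, J s (y + hhR e a c) ≤ ∫⁻ c : ↥(ℝ ∙ e)ᗮ, J s (c : E) := by
  set K : Submodule ℝ E := (ℝ ∙ e)ᗮ
  set c₀ : ↥K := K.orthogonalProjectionOnto (hhR e a y)
  calc ∫⁻ c : ↥K, J s (y + hhR e a c) ≤ ∫⁻ c : ↥K, J s ((c + c₀ : ↥K) : E) := by
        refine lintegral_mono fun c => J_anti hs ?_
        have h1 : ‖y + hhR e a c‖ = ‖hhR e a y + c‖ := by
          rw [← (hhR e a).norm_map (y + hhR e a c), map_add, hhR_hhR]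
        have h2 : K.orthogonalProjectionOnto (hhR e a y + c) = c₀ + c := by
          rw [map_add, Submodule.orthogonalProjectionOnto_mem_subspace_eq_self]
        calc ‖((c + c₀ : ↥K) : E)‖ = ‖c + c₀‖ := rfl
          _ = ‖K.orthogonalProjectionOnto (hhR e a y + c)‖ := by rw [h2, add_comm]
          _ ≤ ‖hhR e a y + c‖ := Submodule.norm_orthogonalProjectionOnto_apply_le _ _
          _ = ‖y + hhR e a c‖ := h1.symm
    _ = ∫⁻ c : ↥K, J s (c : E) := lintegral_add_right_eq_self (fun c : ↥K => J s (c : E)) c₀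

/-- **L2**: `∫ (2‖a‖)⁻¹ (1+‖y+a‖)^{-s} da ≤ ∫_{‖a‖<1} (2‖a‖)⁻¹ + ∫ (1+‖a‖)^{-s}` uniformly in `y`.
[folklore] -/
theorem lintegral_wE_J_le {s : ℝ} (hs : 0 ≤ s) (y : E) :
    ∫⁻ a, wE a * J s (y + a) ≤ (∫⁻ a in Metric.ball (0 : E) 1, wE a) + ∫⁻ a : E, J s a := by
  calc ∫⁻ a, wE a * J s (y + a)
        ≤ ∫⁻ a, ((Metric.ball (0 : E) 1).indicator wE a + J s (y + a)) := by
        refine lintegral_mono fun a => ?_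
        by_cases ha : a ∈ Metric.ball (0 : E) 1
        · rw [indicator_of_mem ha]
          calc wE a * J s (y + a) ≤ wE a * 1 := by gcongr; exact J_le_one hs _
            _ ≤ wE a + J s (y + a) := by rw [mul_one]; exact le_self_add
        · rw [indicator_of_notMem ha, zero_add]
          have ha' : 1 ≤ ‖a‖ := by simpa using ha
          calc wE a * J s (y + a) ≤ 1 * J s (y + a) := by gcongr; exact wE_le_one_of ha'
            _ = J s (y + a) := one_mul _
    _ = (∫⁻ a, (Metric.ball (0 : E) 1).indicator wE a) + ∫⁻ a, J s (y + a) :=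
        lintegral_add_left (measurable_wE.indicator measurableSet_ball) _
    _ = _ := by rw [lintegral_indicator measurableSet_ball, lintegral_add_left_eq_self]

/-- `∫ (1 + ‖x‖)^{-s} dx < ∞` on `E` for `s > dim E` (Mathlib's `finite_integral_one_add_norm`).
[folklore] -/
theorem lintegral_J_lt_top {s : ℝ} (hs : (Module.finrank ℝ E : ℝ) < s) : ∫⁻ x : E, J s x < ∞ :=
  finite_integral_one_add_norm hs

/-- `∫ (1 + ‖c‖)^{-s} dc < ∞` on the hyperplane `(ℝ ∙ e)ᗮ` for `s > dim E - 1` (`dim (ℝ ∙ e)ᗮ = dim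
E - 1`). [folklore] -/
theorem lintegral_J_orth_lt_top {e : E} (he : e ≠ 0) {s : ℝ}
    (hs : (Module.finrank ℝ E : ℝ) - 1 < s) : ∫⁻ c : ↥(ℝ ∙ e)ᗮ, J s (c : E) < ∞ := by
  have hpos : 0 < Module.finrank ℝ E := Module.finrank_pos_iff_exists_ne_zero.mpr ⟨e, he⟩
  haveI : Fact (Module.finrank ℝ E = (Module.finrank ℝ E - 1) + 1) := ⟨by omega⟩
  have hdim : Module.finrank ℝ ↥(ℝ ∙ e)ᗮ = Module.finrank ℝ E - 1 :=
    Submodule.finrank_orthogonal_span_singleton he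
  have hs' : (Module.finrank ℝ ↥(ℝ ∙ e)ᗮ : ℝ) < s := by
    rw [hdim, Nat.cast_sub (by omega)]; simpa using hs
  have := finite_integral_one_add_norm (E := ↥(ℝ ∙ e)ᗮ) (μ := volume) hs'
  simpa [J] using this

/-- The constant of **L2**. [folklore] -/
def CE (E : Type*) [NormedAddCommGroup E] [InnerProductSpace ℝ E] [FiniteDimensional ℝ E]
    [MeasurableSpace E] [BorelSpace E] (s : ℝ) : ℝ≥0∞ :=
  (∫⁻ a in Metric.ball (0 : E) 1, wE a) + ∫⁻ a : E, J s a

/-- The constant of **L2** is finite in dimension `≥ 2` for `s > dim E`. [folklore] -/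
theorem CE_lt_top (hE : 2 ≤ Module.finrank ℝ E) {s : ℝ} (hs : (Module.finrank ℝ E : ℝ) < s) :
    CE E s < ∞ :=
  ENNReal.add_lt_top.mpr ⟨lintegral_wE_ball_lt_top hE, lintegral_J_lt_top hs⟩

/-! ### C. The resonant triple integral in frame coordinates -/

/-- Measurability of the frame map on `E × (ℝ ∙ e)ᗮ`. [folklore] -/
theorem measurable_hhR_sub (e : E) :
    Measurable (fun p : E × ↥(ℝ ∙ e)ᗮ => hhR e p.1 (p.2 : E)) := by
  have h : (fun p : E × ↥(ℝ ∙ e)ᗮ => hhR e p.1 (p.2 : E)) =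
      (fun p : E × E => hhR e p.1 p.2) ∘ (fun p : E × ↥(ℝ ∙ e)ᗮ => (p.1, (p.2 : E))) := rfl
  rw [h]
  exact (measurable_hhR e).comp (measurable_fst.prodMk (measurable_subtype_coe.comp measurable_snd))

/-- `N e F = ∫⁻ k, ∫⁻ a, ∫⁻ c, (2‖a‖)⁻¹ F k a (hhR e a c)`: the lintegral over the resonant manifold,
parametrised by the frame `(ℝ ∙ e)ᗮ`. [folklore] -/
def N (e : E) (F : E → E → E → ℝ≥0∞) : ℝ≥0∞ :=
  ∫⁻ k, ∫⁻ a, ∫⁻ c : ↥(ℝ ∙ e)ᗮ, wE a * F k a (hhR e a c)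

/-- Joint measurability of a three-argument kernel. [folklore] -/
abbrev Meas3 (F : E → E → E → ℝ≥0∞) : Prop := Measurable fun p : E × E × E => F p.1 p.2.1 p.2.2

/-- The frame integrand `(k, a, c) ↦ (2‖a‖)⁻¹ F k a (hhR e a c)` of a jointly measurable kernel is
measurable. [folklore] -/
theorem Meas3.integrand {e : E} {F : E → E → E → ℝ≥0∞} (hF : Meas3 F) :
    Measurable fun q : E × E × ↥(ℝ ∙ e)ᗮ => wE q.2.1 * F q.1 q.2.1 (hhR e q.2.1 q.2.2) := by
  have h1 : Measurable fun q : E × E × ↥(ℝ ∙ e)ᗮ => (q.1, q.2.1, hhR e q.2.1 (q.2.2 : E)) :=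
    measurable_fst.prodMk ((measurable_fst.comp measurable_snd).prodMk
      ((measurable_hhR_sub e).comp measurable_snd))
  exact (measurable_wE.comp (measurable_fst.comp measurable_snd)).mul (hF.comp h1)

/-- Tonelli: the nested resonant integral `N` equals the lower integral over the product `E × E × (ℝ
∙ e)ᗮ`. [folklore] -/
theorem N_eq_flat {e : E} {F : E → E → E → ℝ≥0∞} (hF : Meas3 F) :
    N e F = ∫⁻ q : E × E × ↥(ℝ ∙ e)ᗮ, wE q.2.1 * F q.1 q.2.1 (hhR e q.2.1 q.2.2)
      ∂((volume : Measure E).prod ((volume : Measure E).prod (volume : Measure ↥(ℝ ∙ e)ᗮ))) := by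
  unfold N
  have h1 : ∀ k : E, ∫⁻ a, ∫⁻ c : ↥(ℝ ∙ e)ᗮ, wE a * F k a (hhR e a c) =
      ∫⁻ p : E × ↥(ℝ ∙ e)ᗮ, wE p.1 * F k p.1 (hhR e p.1 p.2)
        ∂((volume : Measure E).prod (volume : Measure ↥(ℝ ∙ e)ᗮ)) := fun k =>
    lintegral_lintegral (hF.integrand.comp measurable_prodMk_left).aemeasurable
  simp_rw [h1]
  exact lintegral_lintegral hF.integrand.aemeasurable

/-- Tonelli: the `k`-integral innermost. [folklore] -/
theorem N_eq_inner {e : E} {F : E → E → E → ℝ≥0∞} (hF : Meas3 F) :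
    N e F = ∫⁻ a, ∫⁻ c : ↥(ℝ ∙ e)ᗮ, ∫⁻ k, wE a * F k a (hhR e a c) := by
  rw [N_eq_flat hF, lintegral_prod _ hF.integrand.aemeasurable]
  have h2 : ∫⁻ k, ∫⁻ p : E × ↥(ℝ ∙ e)ᗮ, wE p.1 * F k p.1 (hhR e p.1 p.2)
      ∂((volume : Measure E).prod (volume : Measure ↥(ℝ ∙ e)ᗮ)) =
      ∫⁻ p : E × ↥(ℝ ∙ e)ᗮ, (∫⁻ k : E, wE p.1 * F k p.1 (hhR e p.1 p.2))
      ∂((volume : Measure E).prod (volume : Measure ↥(ℝ ∙ e)ᗮ)) :=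
    lintegral_lintegral_swap hF.integrand.aemeasurable
  rw [h2]
  exact lintegral_prod _ hF.integrand.lintegral_prod_left'.aemeasurable

/-- `N` is monotone. [folklore] -/
theorem N_mono {e : E} {F G : E → E → E → ℝ≥0∞} (h : ∀ k a b, F k a b ≤ G k a b) :
    N e F ≤ N e G :=
  lintegral_mono fun _ => lintegral_mono fun _ => lintegral_mono fun _ => by gcongr; exact h _ _ _

/-- `N` is additive (measurable kernels). [folklore] -/
theorem N_add {e : E} {F G : E → E → E → ℝ≥0∞} (hF : Meas3 F) (hG : Meas3 G) :
    N e (fun k a b => F k a b + G k a b) = N e F + N e G := by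
  have hFG : Meas3 (fun k a b => F k a b + G k a b) := hF.add hG
  rw [N_eq_flat hFG, N_eq_flat hF, N_eq_flat hG, ← lintegral_add_left hF.integrand]
  congr 1; funext q; rw [mul_add]

/-- `N` commutes with constant multiples (measurable kernels). [folklore] -/
theorem N_const_mul {e : E} {F : E → E → E → ℝ≥0∞} (hF : Meas3 F) (r : ℝ≥0∞) :
    N e (fun k a b => r * F k a b) = r * N e F := by
  have hrF : Meas3 (fun k a b => r * F k a b) := hF.const_mul r
  rw [N_eq_flat hrF, N_eq_flat hF, ← lintegral_const_mul _ hF.integrand]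
  congr 1; funext q; ring

/-- Frame form of `(ℝ ∙ (-a))ᗮ = (ℝ ∙ a)ᗮ`: the frames at `a` and `-a` parametrise the same
hyperplane measure (lower integral). [folklore] -/
theorem lintegral_frame_negA {e a : E} (he : ‖e‖ = 1) (ha : a ≠ 0) (G : E → ℝ≥0∞) :
    ∫⁻ c : ↥(ℝ ∙ e)ᗮ, G (hhR e (-a) c) = ∫⁻ c : ↥(ℝ ∙ e)ᗮ, G (hhR e a c) := by
  rw [← lintegral_orth_eq_frame he (neg_ne_zero.mpr ha), lintegral_orth_neg,
    lintegral_orth_eq_frame he ha]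

/-- Frame form of `b ↦ -b` on the hyperplane (lower integral). [folklore] -/
theorem lintegral_frame_negC (e a : E) (G : E → ℝ≥0∞) :
    ∫⁻ c : ↥(ℝ ∙ e)ᗮ, G (-hhR e a c) = ∫⁻ c : ↥(ℝ ∙ e)ᗮ, G (hhR e a c) := by
  have := lintegral_neg_eq_self (μ := (volume : Measure ↥(ℝ ∙ e)ᗮ)) (fun c => G (hhR e a c))
  simpa using this

/-- **Symmetry** of the resonant measure under `(k, a, b) ↦ (k + a + b, -a, -b)`
(i.e. `(k, k₁, k₂, k₃) ↦ (k₂, k₃, k, k₁)`). [cite: Nazarenko2011, §8.1.3 (8.18)–(8.21)] -/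
theorem N_symm {e : E} (he : ‖e‖ = 1) {F : E → E → E → ℝ≥0∞} (hF : Meas3 F) :
    N e (fun k a b => F (k + a + b) (-a) (-b)) = N e F := by
  have hF' : Meas3 (fun k a b => F (k + a + b) (-a) (-b)) := by
    have h1 : Measurable fun p : E × E × E => (p.1 + p.2.1 + p.2.2, -p.2.1, -p.2.2) := by fun_prop
    exact hF.comp h1
  -- `Φ a := wE a * ∫⁻ c, ∫⁻ k, F k a (R a c)`
  set Φ : E → ℝ≥0∞ := fun a => wE a * ∫⁻ c : ↥(ℝ ∙ e)ᗮ, ∫⁻ k, F k a (hhR e a c) with hΦ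
  have hmeasF : ∀ a b : E, Measurable fun k => F k a b := fun a b =>
    hF.comp (measurable_id.prodMk (measurable_const (a := (a, b))))
  have key : ∀ a : E, (∫⁻ c : ↥(ℝ ∙ e)ᗮ, ∫⁻ k, wE a * F (k + a + hhR e a c) (-a) (-hhR e a c))
      = Φ (-a) := by
    intro a
    by_cases ha : a = 0
    · subst ha; simp [hΦ]
    have h1 : ∀ c : ↥(ℝ ∙ e)ᗮ, (∫⁻ k, wE a * F (k + a + hhR e a c) (-a) (-hhR e a c))
        = wE a * ∫⁻ k, F k (-a) (-hhR e a c) := by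
      intro c
      rw [lintegral_const_mul' _ _ (wE_ne_top a)]
      congr 1
      simp_rw [add_assoc]
      exact lintegral_add_right_eq_self (fun k => F k (-a) (-hhR e a c)) (a + hhR e a c)
    simp_rw [h1]
    rw [lintegral_const_mul' _ _ (wE_ne_top a), hΦ]
    simp only [wE_neg]
    congr 1
    rw [lintegral_frame_negC e a (fun b => ∫⁻ k, F k (-a) b),
      ← lintegral_frame_negA he ha (fun b => ∫⁻ k, F k (-a) b)]
  rw [N_eq_inner hF', N_eq_inner hF]
  simp_rw [key]
  rw [lintegral_neg_eq_self (μ := (volume : Measure E)) Φ]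
  congr 1; funext a
  rw [hΦ]
  simp only
  rw [← lintegral_const_mul' _ _ (wE_ne_top a)]
  congr 1; funext c
  rw [lintegral_const_mul' _ _ (wE_ne_top a)]


/-! ### C3. Finiteness of the weighted envelope integrals -/

/-- Loss-type envelope `J k · J (k+a) · J (k+b)`. [folklore] -/
def T013 (s₁ s₂ s₃ : ℝ) (k a b : E) : ℝ≥0∞ := J s₁ k * J s₂ (k + a) * J s₃ (k + b)

/-- Loss-type envelope `J k · J (k+a) · J (k+a+b)`. [folklore] -/
def T012 (s₁ s₂ s₃ : ℝ) (k a b : E) : ℝ≥0∞ := J s₁ k * J s₂ (k + a) * J s₃ (k + a + b)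

/-- The total weight `‖k‖² + ‖k₁‖² + ‖k₂‖² + ‖k₃‖²`. [folklore] -/
def wt (k a b : E) : ℝ≥0∞ :=
  ENNReal.ofReal (‖k‖ ^ 2) + ENNReal.ofReal (‖k + a‖ ^ 2) + ENNReal.ofReal (‖k + a + b‖ ^ 2)
    + ENNReal.ofReal (‖k + b‖ ^ 2)

/-- The envelope of `|cubicForm n k (k+a) (k+a+b) (k+b)|` when `|n| ≤ (1 + ‖·‖)^{-s}`. [folklore] -/
def env (s : ℝ) (k a b : E) : ℝ≥0∞ :=
  J s (k + a) * J s (k + a + b) * J s (k + b) + J s k * J s (k + a + b) * J s (k + b)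
    + J s k * J s (k + a) * J s (k + b) + J s k * J s (k + a) * J s (k + a + b)

/-- The total weight is jointly measurable. [folklore] -/
@[fun_prop] theorem measurable_wt : Measurable fun p : E × E × E => wt p.1 p.2.1 p.2.2 := by
  unfold wt; fun_prop

/-- **Direct bound** `N (J_{s₁}(k) J_{s₂}(k+a) J_{s₃}(k+b)) ≤ I_E(s₁) · C_E(s₂) · I_{e^⊥}(s₃)`:
integrate the hyperplane variable first (**L1**), then `a` (**L2**), then `k`. [folklore] -/
theorem N_T013_le {s₁ s₂ s₃ : ℝ} (hs₂ : 0 ≤ s₂) (hs₃ : 0 ≤ s₃) (e : E) :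
    N e (T013 s₁ s₂ s₃) ≤
      (∫⁻ k : E, J s₁ k) * (CE E s₂ * ∫⁻ c : ↥(ℝ ∙ e)ᗮ, J s₃ (c : E)) := by
  unfold N T013
  calc ∫⁻ k, ∫⁻ a, ∫⁻ c : ↥(ℝ ∙ e)ᗮ, wE a * (J s₁ k * J s₂ (k + a) * J s₃ (k + hhR e a c))
      = ∫⁻ k, J s₁ k * ∫⁻ a, wE a * J s₂ (k + a) * ∫⁻ c : ↥(ℝ ∙ e)ᗮ, J s₃ (k + hhR e a c) := by
        refine lintegral_congr fun k => ?_
        rw [← lintegral_const_mul' (J s₁ k) _ (J_ne_top _ _)]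
        refine lintegral_congr fun a => ?_
        calc ∫⁻ c : ↥(ℝ ∙ e)ᗮ, wE a * (J s₁ k * J s₂ (k + a) * J s₃ (k + hhR e a c))
            = ∫⁻ c : ↥(ℝ ∙ e)ᗮ, (J s₁ k * (wE a * J s₂ (k + a))) * J s₃ (k + hhR e a c) :=
              lintegral_congr fun c => by ring
          _ = (J s₁ k * (wE a * J s₂ (k + a))) * ∫⁻ c : ↥(ℝ ∙ e)ᗮ, J s₃ (k + hhR e a c) :=
              lintegral_const_mul' _ _ (ENNReal.mul_ne_top (J_ne_top _ _)
                (ENNReal.mul_ne_top (wE_ne_top _) (J_ne_top _ _)))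
          _ = _ := by rw [mul_assoc]
    _ ≤ ∫⁻ k, J s₁ k * ∫⁻ a, wE a * J s₂ (k + a) * ∫⁻ c : ↥(ℝ ∙ e)ᗮ, J s₃ (c : E) :=
        lintegral_mono fun k => mul_le_mul_right (lintegral_mono fun a => mul_le_mul_right
          (lintegral_J_frame_le hs₃ e a k) _) _
    _ ≤ ∫⁻ k, J s₁ k * (CE E s₂ * ∫⁻ c : ↥(ℝ ∙ e)ᗮ, J s₃ (c : E)) := by
        gcongr with k
        rw [lintegral_mul_const _ (by fun_prop)]
        gcongr
        exact lintegral_wE_J_le hs₂ k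
    _ = (∫⁻ k, J s₁ k) * (CE E s₂ * ∫⁻ c : ↥(ℝ ∙ e)ᗮ, J s₃ (c : E)) :=
        lintegral_mul_const _ (measurable_J s₁)

/-- **Direct bound** `N (J_{s₁}(k) J_{s₂}(k+a) J_{s₃}(k+a+b)) ≤ I_E(s₁) · C_E(s₂) · I_{e^⊥}(s₃)` (as
`N_T013_le`, with **L1** centred at `k + a`). [folklore] -/
theorem N_T012_le {s₁ s₂ s₃ : ℝ} (hs₂ : 0 ≤ s₂) (hs₃ : 0 ≤ s₃) (e : E) :
    N e (T012 s₁ s₂ s₃) ≤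
      (∫⁻ k : E, J s₁ k) * (CE E s₂ * ∫⁻ c : ↥(ℝ ∙ e)ᗮ, J s₃ (c : E)) := by
  unfold N T012
  calc ∫⁻ k, ∫⁻ a, ∫⁻ c : ↥(ℝ ∙ e)ᗮ, wE a * (J s₁ k * J s₂ (k + a) * J s₃ (k + a + hhR e a c))
      = ∫⁻ k, J s₁ k * ∫⁻ a, wE a * J s₂ (k + a) * ∫⁻ c : ↥(ℝ ∙ e)ᗮ, J s₃ (k + a + hhR e a c) := by
        refine lintegral_congr fun k => ?_
        rw [← lintegral_const_mul' (J s₁ k) _ (J_ne_top _ _)]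
        refine lintegral_congr fun a => ?_
        calc ∫⁻ c : ↥(ℝ ∙ e)ᗮ, wE a * (J s₁ k * J s₂ (k + a) * J s₃ (k + a + hhR e a c))
            = ∫⁻ c : ↥(ℝ ∙ e)ᗮ, (J s₁ k * (wE a * J s₂ (k + a))) * J s₃ (k + a + hhR e a c) :=
              lintegral_congr fun c => by ring
          _ = (J s₁ k * (wE a * J s₂ (k + a))) * ∫⁻ c : ↥(ℝ ∙ e)ᗮ, J s₃ (k + a + hhR e a c) :=
              lintegral_const_mul' _ _ (ENNReal.mul_ne_top (J_ne_top _ _)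
                (ENNReal.mul_ne_top (wE_ne_top _) (J_ne_top _ _)))
          _ = _ := by rw [mul_assoc]
    _ ≤ ∫⁻ k, J s₁ k * ∫⁻ a, wE a * J s₂ (k + a) * ∫⁻ c : ↥(ℝ ∙ e)ᗮ, J s₃ (c : E) :=
        lintegral_mono fun k => mul_le_mul_right (lintegral_mono fun a => mul_le_mul_right
          (lintegral_J_frame_le hs₃ e a (k + a)) _) _
    _ ≤ ∫⁻ k, J s₁ k * (CE E s₂ * ∫⁻ c : ↥(ℝ ∙ e)ᗮ, J s₃ (c : E)) := by
        gcongr with k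
        rw [lintegral_mul_const _ (by fun_prop)]
        gcongr
        exact lintegral_wE_J_le hs₂ k
    _ = (∫⁻ k, J s₁ k) * (CE E s₂ * ∫⁻ c : ↥(ℝ ∙ e)ᗮ, J s₃ (c : E)) :=
        lintegral_mul_const _ (measurable_J s₁)

/-- Standing hypotheses for finiteness: `e` a unit vector, `dim E ≥ 2`, `s > dim E + 2`.
[folklore] -/
structure FinHyp (e : E) (s : ℝ) : Prop where
  he : ‖e‖ = 1
  hE : 2 ≤ Module.finrank ℝ E
  hs : (Module.finrank ℝ E : ℝ) + 2 < s

namespace FinHyp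

variable {e : E} {s : ℝ}

omit [FiniteDimensional ℝ E] [MeasurableSpace E] [BorelSpace E] in
/-- The frame vector is nonzero. [folklore] -/
theorem e_ne (h : FinHyp e s) : e ≠ 0 := by
  intro h0; have := h.he; rw [h0, norm_zero] at this; exact zero_ne_one this

omit [FiniteDimensional ℝ E] [MeasurableSpace E] [BorelSpace E] in
/-- `0 ≤ s`. [folklore] -/
theorem s_nonneg (h : FinHyp e s) : 0 ≤ s := by
  have := h.hs; have := (Module.finrank ℝ E).cast_nonneg (α := ℝ); linarith

omit [FiniteDimensional ℝ E] [MeasurableSpace E] [BorelSpace E] in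
/-- `0 ≤ s - 2`. [folklore] -/
theorem s2_nonneg (h : FinHyp e s) : 0 ≤ s - 2 := by
  have := h.hs; have := (Module.finrank ℝ E).cast_nonneg (α := ℝ); linarith

/-- `I_E(s) < ∞`. [folklore] -/
theorem IE (h : FinHyp e s) : ∫⁻ k : E, J s k < ∞ := lintegral_J_lt_top (by linarith [h.hs])
/-- `I_E(s-2) < ∞` (this is where `s > dim E + 2` is used). [folklore] -/
theorem IE2 (h : FinHyp e s) : ∫⁻ k : E, J (s - 2) k < ∞ := lintegral_J_lt_top (by linarith [h.hs])
/-- `I_{e^⊥}(s) < ∞`. [folklore] -/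
theorem IK (h : FinHyp e s) : ∫⁻ c : ↥(ℝ ∙ e)ᗮ, J s (c : E) < ∞ :=
  lintegral_J_orth_lt_top h.e_ne (by linarith [h.hs])
/-- `I_{e^⊥}(s-2) < ∞`. [folklore] -/
theorem IK2 (h : FinHyp e s) : ∫⁻ c : ↥(ℝ ∙ e)ᗮ, J (s - 2) (c : E) < ∞ :=
  lintegral_J_orth_lt_top h.e_ne (by linarith [h.hs])
/-- `C_E(s) < ∞`. [folklore] -/
theorem C1 (h : FinHyp e s) : CE E s < ∞ := CE_lt_top h.hE (by linarith [h.hs])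
/-- `C_E(s-2) < ∞`. [folklore] -/
theorem C2 (h : FinHyp e s) : CE E (s - 2) < ∞ := CE_lt_top h.hE (by linarith [h.hs])

/-- All `T013` envelopes with exponents in `{s, s-2}` have finite resonant integral. [folklore] -/
theorem T013_fin (h : FinHyp e s) {s₁ s₂ s₃ : ℝ} (h₁ : s₁ = s ∨ s₁ = s - 2)
    (h₂ : s₂ = s ∨ s₂ = s - 2) (h₃ : s₃ = s ∨ s₃ = s - 2) : N e (T013 s₁ s₂ s₃) < ∞ := by
  refine lt_of_le_of_lt (N_T013_le (by rcases h₂ with rfl | rfl <;> [exact h.s_nonneg; exact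
    h.s2_nonneg]) (by rcases h₃ with rfl | rfl <;> [exact h.s_nonneg; exact h.s2_nonneg]) e) ?_
  refine ENNReal.mul_lt_top ?_ (ENNReal.mul_lt_top ?_ ?_)
  · rcases h₁ with rfl | rfl <;> [exact h.IE; exact h.IE2]
  · rcases h₂ with rfl | rfl <;> [exact h.C1; exact h.C2]
  · rcases h₃ with rfl | rfl <;> [exact h.IK; exact h.IK2]

/-- All `T012` envelopes with exponents in `{s, s-2}` have finite resonant integral. [folklore] -/
theorem T012_fin (h : FinHyp e s) {s₁ s₂ s₃ : ℝ} (h₁ : s₁ = s ∨ s₁ = s - 2)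
    (h₂ : s₂ = s ∨ s₂ = s - 2) (h₃ : s₃ = s ∨ s₃ = s - 2) : N e (T012 s₁ s₂ s₃) < ∞ := by
  refine lt_of_le_of_lt (N_T012_le (by rcases h₂ with rfl | rfl <;> [exact h.s_nonneg; exact
    h.s2_nonneg]) (by rcases h₃ with rfl | rfl <;> [exact h.s_nonneg; exact h.s2_nonneg]) e) ?_
  refine ENNReal.mul_lt_top ?_ (ENNReal.mul_lt_top ?_ ?_)
  · rcases h₁ with rfl | rfl <;> [exact h.IE; exact h.IE2]
  · rcases h₂ with rfl | rfl <;> [exact h.C1; exact h.C2]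
  · rcases h₃ with rfl | rfl <;> [exact h.IK; exact h.IK2]

/-- `N (wt · T013) < ∞`. [folklore] -/
theorem wt_T013_fin (h : FinHyp e s) : N e (fun k a b => wt k a b * T013 s s s k a b) < ∞ := by
  -- the four pieces
  have m0 : Meas3 (fun k a b : E => ENNReal.ofReal (‖k‖ ^ 2) * T013 s s s k a b) := by
    unfold Meas3 T013; fun_prop
  have m1 : Meas3 (fun k a b : E => ENNReal.ofReal (‖k + a‖ ^ 2) * T013 s s s k a b) := by
    unfold Meas3 T013; fun_prop
  have m2 : Meas3 (fun k a b : E => ENNReal.ofReal (‖k + a + b‖ ^ 2) * T013 s s s k a b) := by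
    unfold Meas3 T013; fun_prop
  have m3 : Meas3 (fun k a b : E => ENNReal.ofReal (‖k + b‖ ^ 2) * T013 s s s k a b) := by
    unfold Meas3 T013; fun_prop
  have f0 : N e (fun k a b : E => ENNReal.ofReal (‖k‖ ^ 2) * T013 s s s k a b) < ∞ := by
    refine lt_of_le_of_lt (N_mono fun k a b => ?_) (h.T013_fin (Or.inr rfl) (Or.inl rfl) (Or.inl rfl))
    unfold T013
    calc ENNReal.ofReal (‖k‖ ^ 2) * (J s k * J s (k + a) * J s (k + b))
        = (ENNReal.ofReal (‖k‖ ^ 2) * J s k) * J s (k + a) * J s (k + b) := by ring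
      _ ≤ J (s - 2) k * J s (k + a) * J s (k + b) := by gcongr; exact normSq_mul_J_le s k
  have f1 : N e (fun k a b : E => ENNReal.ofReal (‖k + a‖ ^ 2) * T013 s s s k a b) < ∞ := by
    refine lt_of_le_of_lt (N_mono fun k a b => ?_) (h.T013_fin (Or.inl rfl) (Or.inr rfl) (Or.inl rfl))
    unfold T013
    calc ENNReal.ofReal (‖k + a‖ ^ 2) * (J s k * J s (k + a) * J s (k + b))
        = J s k * (ENNReal.ofReal (‖k + a‖ ^ 2) * J s (k + a)) * J s (k + b) := by ring
      _ ≤ J s k * J (s - 2) (k + a) * J s (k + b) := by gcongr; exact normSq_mul_J_le s (k + a)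
  have f3 : N e (fun k a b : E => ENNReal.ofReal (‖k + b‖ ^ 2) * T013 s s s k a b) < ∞ := by
    refine lt_of_le_of_lt (N_mono fun k a b => ?_) (h.T013_fin (Or.inl rfl) (Or.inl rfl) (Or.inr rfl))
    unfold T013
    calc ENNReal.ofReal (‖k + b‖ ^ 2) * (J s k * J s (k + a) * J s (k + b))
        = J s k * J s (k + a) * (ENNReal.ofReal (‖k + b‖ ^ 2) * J s (k + b)) := by ring
      _ ≤ J s k * J s (k + a) * J (s - 2) (k + b) := by gcongr; exact normSq_mul_J_le s (k + b)
  have f2 : N e (fun k a b : E => ENNReal.ofReal (‖k + a + b‖ ^ 2) * T013 s s s k a b) < ∞ := by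
    have hle : ∀ k a b : E, ENNReal.ofReal (‖k + a + b‖ ^ 2) * T013 s s s k a b ≤
        3 * (ENNReal.ofReal (‖k + a‖ ^ 2) * T013 s s s k a b
          + (ENNReal.ofReal (‖k + b‖ ^ 2) * T013 s s s k a b
          + ENNReal.ofReal (‖k‖ ^ 2) * T013 s s s k a b)) := by
      intro k a b
      have := normSq_three_le (k + a) (k + b) k
      rw [show k + a + (k + b) - k = k + a + b by abel] at this
      calc ENNReal.ofReal (‖k + a + b‖ ^ 2) * T013 s s s k a b
          ≤ (3 * (ENNReal.ofReal (‖k + a‖ ^ 2) + ENNReal.ofReal (‖k + b‖ ^ 2)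
              + ENNReal.ofReal (‖k‖ ^ 2))) * T013 s s s k a b := by gcongr
        _ = _ := by ring
    refine lt_of_le_of_lt (N_mono hle) ?_
    rw [N_const_mul (m1.add (m3.add m0)), N_add m1 (m3.add m0), N_add m3 m0]
    exact ENNReal.mul_lt_top (by simp) (ENNReal.add_lt_top.mpr ⟨f1, ENNReal.add_lt_top.mpr ⟨f3, f0⟩⟩)
  have hsum : ∀ k a b : E, wt k a b * T013 s s s k a b =
      ENNReal.ofReal (‖k‖ ^ 2) * T013 s s s k a b + (ENNReal.ofReal (‖k + a‖ ^ 2) * T013 s s s k a b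
      + (ENNReal.ofReal (‖k + a + b‖ ^ 2) * T013 s s s k a b
      + ENNReal.ofReal (‖k + b‖ ^ 2) * T013 s s s k a b)) := by
    intro k a b; unfold wt; ring
  simp_rw [hsum]
  rw [N_add m0 (m1.add (m2.add m3)), N_add m1 (m2.add m3), N_add m2 m3]
  exact ENNReal.add_lt_top.mpr ⟨f0, ENNReal.add_lt_top.mpr ⟨f1, ENNReal.add_lt_top.mpr ⟨f2, f3⟩⟩⟩

/-- `N (wt · T012) < ∞`. [folklore] -/
theorem wt_T012_fin (h : FinHyp e s) : N e (fun k a b => wt k a b * T012 s s s k a b) < ∞ := by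
  have m0 : Meas3 (fun k a b : E => ENNReal.ofReal (‖k‖ ^ 2) * T012 s s s k a b) := by
    unfold Meas3 T012; fun_prop
  have m1 : Meas3 (fun k a b : E => ENNReal.ofReal (‖k + a‖ ^ 2) * T012 s s s k a b) := by
    unfold Meas3 T012; fun_prop
  have m2 : Meas3 (fun k a b : E => ENNReal.ofReal (‖k + a + b‖ ^ 2) * T012 s s s k a b) := by
    unfold Meas3 T012; fun_prop
  have m3 : Meas3 (fun k a b : E => ENNReal.ofReal (‖k + b‖ ^ 2) * T012 s s s k a b) := by
    unfold Meas3 T012; fun_prop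
  have f0 : N e (fun k a b : E => ENNReal.ofReal (‖k‖ ^ 2) * T012 s s s k a b) < ∞ := by
    refine lt_of_le_of_lt (N_mono fun k a b => ?_) (h.T012_fin (Or.inr rfl) (Or.inl rfl) (Or.inl rfl))
    unfold T012
    calc ENNReal.ofReal (‖k‖ ^ 2) * (J s k * J s (k + a) * J s (k + a + b))
        = (ENNReal.ofReal (‖k‖ ^ 2) * J s k) * J s (k + a) * J s (k + a + b) := by ring
      _ ≤ J (s - 2) k * J s (k + a) * J s (k + a + b) := by gcongr; exact normSq_mul_J_le s k
  have f1 : N e (fun k a b : E => ENNReal.ofReal (‖k + a‖ ^ 2) * T012 s s s k a b) < ∞ := by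
    refine lt_of_le_of_lt (N_mono fun k a b => ?_) (h.T012_fin (Or.inl rfl) (Or.inr rfl) (Or.inl rfl))
    unfold T012
    calc ENNReal.ofReal (‖k + a‖ ^ 2) * (J s k * J s (k + a) * J s (k + a + b))
        = J s k * (ENNReal.ofReal (‖k + a‖ ^ 2) * J s (k + a)) * J s (k + a + b) := by ring
      _ ≤ J s k * J (s - 2) (k + a) * J s (k + a + b) := by
          gcongr; exact normSq_mul_J_le s (k + a)
  have f2 : N e (fun k a b : E => ENNReal.ofReal (‖k + a + b‖ ^ 2) * T012 s s s k a b) < ∞ := by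
    refine lt_of_le_of_lt (N_mono fun k a b => ?_) (h.T012_fin (Or.inl rfl) (Or.inl rfl) (Or.inr rfl))
    unfold T012
    calc ENNReal.ofReal (‖k + a + b‖ ^ 2) * (J s k * J s (k + a) * J s (k + a + b))
        = J s k * J s (k + a) * (ENNReal.ofReal (‖k + a + b‖ ^ 2) * J s (k + a + b)) := by ring
      _ ≤ J s k * J s (k + a) * J (s - 2) (k + a + b) := by
          gcongr; exact normSq_mul_J_le s (k + a + b)
  have f3 : N e (fun k a b : E => ENNReal.ofReal (‖k + b‖ ^ 2) * T012 s s s k a b) < ∞ := by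
    have hle : ∀ k a b : E, ENNReal.ofReal (‖k + b‖ ^ 2) * T012 s s s k a b ≤
        3 * (ENNReal.ofReal (‖k‖ ^ 2) * T012 s s s k a b
          + (ENNReal.ofReal (‖k + a + b‖ ^ 2) * T012 s s s k a b
          + ENNReal.ofReal (‖k + a‖ ^ 2) * T012 s s s k a b)) := by
      intro k a b
      have := normSq_three_le k (k + a + b) (k + a)
      rw [show k + (k + a + b) - (k + a) = k + b by abel] at this
      calc ENNReal.ofReal (‖k + b‖ ^ 2) * T012 s s s k a b
          ≤ (3 * (ENNReal.ofReal (‖k‖ ^ 2) + ENNReal.ofReal (‖k + a + b‖ ^ 2)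
              + ENNReal.ofReal (‖k + a‖ ^ 2))) * T012 s s s k a b := by gcongr
        _ = _ := by ring
    refine lt_of_le_of_lt (N_mono hle) ?_
    rw [N_const_mul (m0.add (m2.add m1)), N_add m0 (m2.add m1), N_add m2 m1]
    exact ENNReal.mul_lt_top (by simp) (ENNReal.add_lt_top.mpr ⟨f0, ENNReal.add_lt_top.mpr ⟨f2, f1⟩⟩)
  have hsum : ∀ k a b : E, wt k a b * T012 s s s k a b =
      ENNReal.ofReal (‖k‖ ^ 2) * T012 s s s k a b + (ENNReal.ofReal (‖k + a‖ ^ 2) * T012 s s s k a b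
      + (ENNReal.ofReal (‖k + a + b‖ ^ 2) * T012 s s s k a b
      + ENNReal.ofReal (‖k + b‖ ^ 2) * T012 s s s k a b)) := by
    intro k a b; unfold wt; ring
  simp_rw [hsum]
  rw [N_add m0 (m1.add (m2.add m3)), N_add m1 (m2.add m3), N_add m2 m3]
  exact ENNReal.add_lt_top.mpr ⟨f0, ENNReal.add_lt_top.mpr ⟨f1, ENNReal.add_lt_top.mpr ⟨f2, f3⟩⟩⟩

/-- **The weighted envelope has finite resonant integral**: `N (wt · env) < ∞`. [folklore] -/
theorem wt_env_fin (h : FinHyp e s) : N e (fun k a b => wt k a b * env s k a b) < ∞ := by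
  have mA : Meas3 (fun k a b : E => wt k a b * T013 s s s k a b) := by unfold Meas3 T013; fun_prop
  have mB : Meas3 (fun k a b : E => wt k a b * T012 s s s k a b) := by unfold Meas3 T012; fun_prop
  have m123 : Meas3 (fun k a b : E => wt k a b * (J s (k + a) * J s (k + a + b) * J s (k + b))) := by
    unfold Meas3; fun_prop
  have m023 : Meas3 (fun k a b : E => wt k a b * (J s k * J s (k + a + b) * J s (k + b))) := by
    unfold Meas3; fun_prop
  -- symmetric partners
  have g123 : N e (fun k a b : E => wt k a b * (J s (k + a) * J s (k + a + b) * J s (k + b)))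
      = N e (fun k a b => wt k a b * T013 s s s k a b) := by
    rw [← N_symm h.he mA]
    congr 1; funext k a b
    simp only [wt, T013]
    rw [show k + a + b + -a = k + b by abel, show k + a + b + -b = k + a by abel,
      show k + b + -b = k by abel]
    ring
  have g023 : N e (fun k a b : E => wt k a b * (J s k * J s (k + a + b) * J s (k + b)))
      = N e (fun k a b => wt k a b * T012 s s s k a b) := by
    rw [← N_symm h.he mB]
    congr 1; funext k a b
    simp only [wt, T012]
    rw [show k + a + b + -a = k + b by abel, show k + a + b + -b = k + a by abel,
      show k + b + -b = k by abel]
    ring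
  have hsum : ∀ k a b : E, wt k a b * env s k a b =
      wt k a b * (J s (k + a) * J s (k + a + b) * J s (k + b))
      + (wt k a b * (J s k * J s (k + a + b) * J s (k + b))
      + (wt k a b * T013 s s s k a b + wt k a b * T012 s s s k a b)) := by
    intro k a b; unfold env T013 T012; ring
  simp_rw [hsum]
  rw [N_add m123 (m023.add (mA.add mB)), N_add m023 (mA.add mB), N_add mA mB, g123, g023]
  exact ENNReal.add_lt_top.mpr ⟨h.wt_T013_fin, ENNReal.add_lt_top.mpr ⟨h.wt_T012_fin,
    ENNReal.add_lt_top.mpr ⟨h.wt_T013_fin, h.wt_T012_fin⟩⟩⟩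

end FinHyp


/-! ### D. The weighted collision integral vanishes -/

section Vanishing

variable {e : E} {s C : ℝ} {n : E → ℝ}

omit [NormedAddCommGroup E] [InnerProductSpace ℝ E] [FiniteDimensional ℝ E] [MeasurableSpace E]
  [BorelSpace E] in
/-- Antisymmetry of the kinetic integrand under `(k, k₂) ↔ (k₁, k₃)` (the exchange behind
Nazarenko's change of variables `k ⇄ k₁`). [cite: Nazarenko2011, §8.1.3 (8.18)–(8.21)] -/
theorem cubicForm_swap01 (n : E → ℝ) (k₀ k₁ k₂ k₃ : E) :
    cubicForm n k₁ k₀ k₃ k₂ = -cubicForm n k₀ k₁ k₂ k₃ := by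
  unfold cubicForm; ring

omit [NormedAddCommGroup E] [InnerProductSpace ℝ E] [FiniteDimensional ℝ E] [MeasurableSpace E]
  [BorelSpace E] in
/-- Symmetry of the kinetic integrand under `k ↔ k₂`, `k₁ ↔ k₃`. [cite: Nazarenko2011, §8.1.3
(8.18)–(8.21)] -/
theorem cubicForm_swap02 (n : E → ℝ) (k₀ k₁ k₂ k₃ : E) :
    cubicForm n k₂ k₃ k₀ k₁ = cubicForm n k₀ k₁ k₂ k₃ := by
  unfold cubicForm; ring

omit [NormedAddCommGroup E] [InnerProductSpace ℝ E] [FiniteDimensional ℝ E] [MeasurableSpace E]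
  [BorelSpace E] in
/-- Antisymmetry of the kinetic integrand under `k ↔ k₃`, `k₁ ↔ k₂`. [cite: Nazarenko2011, §8.1.3
(8.18)–(8.21)] -/
theorem cubicForm_swap03 (n : E → ℝ) (k₀ k₁ k₂ k₃ : E) :
    cubicForm n k₃ k₂ k₁ k₀ = -cubicForm n k₀ k₁ k₂ k₃ := by
  unfold cubicForm; ring

/-- The collision integral in frame coordinates (pointwise in `a`; at `a = 0` the weight vanishes).
[cite: Nazarenko2011, §8.1.3 (8.18)–(8.21)] -/
theorem collision_frame (he : ‖e‖ = 1) (n : E → ℝ) (k : E) :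
    collision n k = ∫ a, (2 * ‖a‖)⁻¹ * ∫ c : ↥(ℝ ∙ e)ᗮ,
      cubicForm n k (k + a) (k + a + hhR e a c) (k + hhR e a c) := by
  unfold collision
  congr 1; funext a
  by_cases ha : a = 0
  · subst ha; simp
  · rw [integral_orth_eq_frame he ha (fun b => cubicForm n k (k + a) (k + a + b) (k + b))]

/-- Frame form of `(ℝ ∙ (-a))ᗮ = (ℝ ∙ a)ᗮ` (Bochner integral). [folklore] -/
theorem integral_frame_negA {G : Type*} [NormedAddCommGroup G] [NormedSpace ℝ G] {a : E}
    (he : ‖e‖ = 1) (ha : a ≠ 0) (g : E → G) :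
    ∫ c : ↥(ℝ ∙ e)ᗮ, g (hhR e (-a) c) = ∫ c : ↥(ℝ ∙ e)ᗮ, g (hhR e a c) := by
  rw [← integral_orth_eq_frame he (neg_ne_zero.mpr ha), integral_orth_neg,
    integral_orth_eq_frame he ha]

/-- Frame form of `b ↦ -b` on the hyperplane (Bochner integral). [folklore] -/
theorem integral_frame_negC {G : Type*} [NormedAddCommGroup G] [NormedSpace ℝ G] (e a : E)
    (g : E → G) : ∫ c : ↥(ℝ ∙ e)ᗮ, g (-hhR e a c) = ∫ c : ↥(ℝ ∙ e)ᗮ, g (hhR e a c) := by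
  have := integral_neg_eq_self (fun c : ↥(ℝ ∙ e)ᗮ => g (hhR e a c)) volume
  simpa using this

/-- `a ↦ -a` symmetry of `∫ (2‖a‖)⁻¹ ∫_{frame} …` (no integrability needed). [folklore] -/
theorem integral_w_frame_negA (he : ‖e‖ = 1) (g : E → E → ℝ) :
    ∫ a, (2 * ‖a‖)⁻¹ * ∫ c : ↥(ℝ ∙ e)ᗮ, g (-a) (hhR e a c) =
      ∫ a, (2 * ‖a‖)⁻¹ * ∫ c : ↥(ℝ ∙ e)ᗮ, g a (hhR e a c) := by
  have h1 : ∀ a : E, (2 * ‖a‖)⁻¹ * ∫ c : ↥(ℝ ∙ e)ᗮ, g (-a) (hhR e a c) =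
      (fun a' => (2 * ‖a'‖)⁻¹ * ∫ c : ↥(ℝ ∙ e)ᗮ, g a' (hhR e a' c)) (-a) := by
    intro a
    by_cases ha : a = 0
    · subst ha; simp
    · simp only [norm_neg]
      rw [integral_frame_negA he ha (g (-a))]
  simp_rw [h1]
  exact integral_neg_eq_self (fun a' => (2 * ‖a'‖)⁻¹ * ∫ c : ↥(ℝ ∙ e)ᗮ, g a' (hhR e a' c)) volume

/-- Real envelope. [folklore] -/
def jr (s : ℝ) (x : E) : ℝ := (1 + ‖x‖) ^ (-s)

omit [InnerProductSpace ℝ E] [FiniteDimensional ℝ E] [MeasurableSpace E] [BorelSpace E] in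
/-- The real envelope is nonnegative. [folklore] -/
theorem jr_nonneg (s : ℝ) (x : E) : 0 ≤ jr s x := by unfold jr; positivity

omit [InnerProductSpace ℝ E] [FiniteDimensional ℝ E] [MeasurableSpace E] [BorelSpace E] in
/-- `ENNReal.ofReal ∘ jr s = J s`. [folklore] -/
theorem ofReal_jr (s : ℝ) (x : E) : ENNReal.ofReal (jr s x) = J s x := rfl

/-- Decay hypothesis on a spectrum. [folklore] -/
def Decays (C s : ℝ) (n : E → ℝ) : Prop := ∀ x, |n x| ≤ C * jr s x

omit [InnerProductSpace ℝ E] [FiniteDimensional ℝ E] [MeasurableSpace E] [BorelSpace E] in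
/-- A decay constant is nonnegative. [folklore] -/
theorem Decays.C_nonneg (h : Decays C s n) : 0 ≤ C := by
  have h0 := h 0
  have : 0 < jr s (0 : E) := by unfold jr; positivity
  nlinarith [abs_nonneg (n 0)]

omit [InnerProductSpace ℝ E] [FiniteDimensional ℝ E] [MeasurableSpace E] [BorelSpace E] in
/-- Triple products of a decaying spectrum are dominated by `C³` times the product envelope.
[folklore] -/
theorem Decays.prod3 (h : Decays C s n) (x y z : E) :
    |n x * n y * n z| ≤ C ^ 3 * (jr s x * jr s y * jr s z) := by
  rw [abs_mul, abs_mul]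
  have hx := h x; have hy := h y; have hz := h z
  have hC := h.C_nonneg
  have h1 := jr_nonneg s x; have h2 := jr_nonneg s y; have h3 := jr_nonneg s z
  calc |n x| * |n y| * |n z| ≤ (C * jr s x) * (C * jr s y) * (C * jr s z) :=
        mul_le_mul (mul_le_mul hx hy (abs_nonneg _) (by positivity)) hz (abs_nonneg _)
          (by positivity)
    _ = C ^ 3 * (jr s x * jr s y * jr s z) := by ring

omit [InnerProductSpace ℝ E] [FiniteDimensional ℝ E] [MeasurableSpace E] [BorelSpace E] in
/-- **Envelope domination**: `‖cubicForm n k (k+a) (k+a+b) (k+b)‖ₑ ≤ C³ · env s k a b`.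
[folklore] -/
theorem Decays.enorm_cubicForm_le (h : Decays C s n) (k a b : E) :
    ‖cubicForm n k (k + a) (k + a + b) (k + b)‖ₑ ≤ ENNReal.ofReal (C ^ 3) * env s k a b := by
  have hC := h.C_nonneg
  set j0 := jr s k; set j1 := jr s (k + a); set j2 := jr s (k + a + b); set j3 := jr s (k + b)
  have hreal : |cubicForm n k (k + a) (k + a + b) (k + b)| ≤
      C ^ 3 * (j1 * j2 * j3 + j0 * j2 * j3 + j0 * j1 * j3 + j0 * j1 * j2) := by
    unfold cubicForm
    have e1 := h.prod3 (k + a) (k + a + b) (k + b)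
    have e2 := h.prod3 k (k + a + b) (k + b)
    have e3 := h.prod3 k (k + a) (k + b)
    have e4 := h.prod3 k (k + a) (k + a + b)
    calc |n (k + a) * n (k + a + b) * n (k + b) - n k * n (k + a + b) * n (k + b)
          + n k * n (k + a) * n (k + b) - n k * n (k + a) * n (k + a + b)|
        ≤ |n (k + a) * n (k + a + b) * n (k + b)| + |n k * n (k + a + b) * n (k + b)|
          + |n k * n (k + a) * n (k + b)| + |n k * n (k + a) * n (k + a + b)| := by
          refine (abs_sub _ _).trans ?_
          gcongr
          refine (abs_add_le _ _).trans ?_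
          gcongr
          exact abs_sub _ _
      _ ≤ _ := by linarith
  rw [Real.enorm_eq_ofReal_abs]
  refine (ENNReal.ofReal_le_ofReal hreal).trans (le_of_eq ?_)
  have hj0 := jr_nonneg s k; have hj1 := jr_nonneg s (k + a)
  have hj2 := jr_nonneg s (k + a + b); have hj3 := jr_nonneg s (k + b)
  unfold env
  rw [← ofReal_jr, ← ofReal_jr, ← ofReal_jr, ← ofReal_jr]
  rw [ENNReal.ofReal_mul (pow_nonneg hC 3), ENNReal.ofReal_add (by positivity) (by positivity),
    ENNReal.ofReal_add (by positivity) (by positivity), ENNReal.ofReal_add (by positivity)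
    (by positivity), ENNReal.ofReal_mul (by positivity), ENNReal.ofReal_mul (by positivity),
    ENNReal.ofReal_mul (by positivity), ENNReal.ofReal_mul (by positivity),
    ENNReal.ofReal_mul (by positivity), ENNReal.ofReal_mul (by positivity),
    ENNReal.ofReal_mul (by positivity), ENNReal.ofReal_mul (by positivity)]

/-- The four weights. [folklore] -/
def wgt (i : Fin 4) (k a b : E) : ℝ :=
  ‖k + (if i = 1 ∨ i = 2 then a else 0) + (if i = 2 ∨ i = 3 then b else 0)‖ ^ 2

omit [InnerProductSpace ℝ E] [FiniteDimensional ℝ E] [MeasurableSpace E] [BorelSpace E] in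
/-- `wgt 0 = ‖k‖²`. [folklore] -/
@[simp] theorem wgt_zero (k a b : E) : wgt 0 k a b = ‖k‖ ^ 2 := by simp [wgt]

omit [InnerProductSpace ℝ E] [FiniteDimensional ℝ E] [MeasurableSpace E] [BorelSpace E] in
/-- `wgt 1 = ‖k₁‖² = ‖k + a‖²`. [folklore] -/
@[simp] theorem wgt_one (k a b : E) : wgt 1 k a b = ‖k + a‖ ^ 2 := by simp [wgt]

omit [InnerProductSpace ℝ E] [FiniteDimensional ℝ E] [MeasurableSpace E] [BorelSpace E] in
/-- `wgt 2 = ‖k₂‖² = ‖k + a + b‖²`. [folklore] -/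
@[simp] theorem wgt_two (k a b : E) : wgt 2 k a b = ‖k + a + b‖ ^ 2 := by simp [wgt]

omit [InnerProductSpace ℝ E] [FiniteDimensional ℝ E] [MeasurableSpace E] [BorelSpace E] in
/-- `wgt 3 = ‖k₃‖² = ‖k + b‖²`. [folklore] -/
@[simp] theorem wgt_three (k a b : E) : wgt 3 k a b = ‖k + b‖ ^ 2 := by simp [wgt]

omit [InnerProductSpace ℝ E] [FiniteDimensional ℝ E] [MeasurableSpace E] [BorelSpace E] in
/-- Weights are nonnegative. [folklore] -/
theorem wgt_nonneg (i : Fin 4) (k a b : E) : 0 ≤ wgt i k a b := by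
  unfold wgt; positivity

omit [InnerProductSpace ℝ E] [FiniteDimensional ℝ E] [MeasurableSpace E] [BorelSpace E] in
/-- Each weight is dominated by the total weight `wt`. [folklore] -/
theorem ofReal_wgt_le_wt (i : Fin 4) (k a b : E) : ENNReal.ofReal (wgt i k a b) ≤ wt k a b := by
  unfold wt wgt
  split_ifs <;> (try simp only [add_zero]) <;>
    first
    | exact le_add_self
    | exact le_add_right le_add_self
    | exact le_add_right (le_add_right le_add_self)
    | exact le_add_right (le_add_right le_self_add)

/-- Weights are jointly measurable. [folklore] -/
theorem measurable_wgt (i : Fin 4) : Measurable fun p : E × E × E => wgt i p.1 p.2.1 p.2.2 := by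
  unfold wgt; split_ifs <;> fun_prop

/-- The weighted frame integrands `Ψᵢ(k, a, c) = (2‖a‖)⁻¹ · wgtᵢ · cubicForm` on `E × E × (ℝ∙e)ᗮ`.
[folklore] -/
def Ψ (e : E) (n : E → ℝ) (i : Fin 4) (q : E × E × ↥(ℝ ∙ e)ᗮ) : ℝ :=
  (2 * ‖q.2.1‖)⁻¹ * (wgt i q.1 q.2.1 (hhR e q.2.1 q.2.2) *
    cubicForm n q.1 (q.1 + q.2.1) (q.1 + q.2.1 + hhR e q.2.1 q.2.2) (q.1 + hhR e q.2.1 q.2.2))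

/-- The weighted frame integrands are measurable (for a measurable spectrum). [folklore] -/
theorem measurable_Ψ (hn : Measurable n) (i : Fin 4) : Measurable (Ψ e n i) := by
  unfold Ψ cubicForm
  have hρ : Measurable fun q : E × E × ↥(ℝ ∙ e)ᗮ => hhR e q.2.1 (q.2.2 : E) :=
    (measurable_hhR_sub e).comp measurable_snd
  have hk : Measurable fun q : E × E × ↥(ℝ ∙ e)ᗮ => q.1 := measurable_fst
  have ha : Measurable fun q : E × E × ↥(ℝ ∙ e)ᗮ => q.2.1 := measurable_fst.comp measurable_snd
  have hw : Measurable fun q : E × E × ↥(ℝ ∙ e)ᗮ => wgt i q.1 q.2.1 (hhR e q.2.1 (q.2.2 : E)) :=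
    (measurable_wgt i).comp (hk.prodMk (ha.prodMk hρ))
  have h0 : Measurable fun q : E × E × ↥(ℝ ∙ e)ᗮ => n q.1 := hn.comp hk
  have h1 : Measurable fun q : E × E × ↥(ℝ ∙ e)ᗮ => n (q.1 + q.2.1) := hn.comp (hk.add ha)
  have h2 : Measurable fun q : E × E × ↥(ℝ ∙ e)ᗮ => n (q.1 + q.2.1 + hhR e q.2.1 (q.2.2 : E)) :=
    hn.comp ((hk.add ha).add hρ)
  have h3 : Measurable fun q : E × E × ↥(ℝ ∙ e)ᗮ => n (q.1 + hhR e q.2.1 (q.2.2 : E)) :=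
    hn.comp (hk.add hρ)
  fun_prop

omit [FiniteDimensional ℝ E] [MeasurableSpace E] [BorelSpace E] in
/-- Envelope domination of the weighted frame integrands: `‖Ψᵢ‖ₑ ≤ C³ · (2‖a‖)⁻¹ · wt · env`.
[folklore] -/
theorem enorm_Ψ_le (h : Decays C s n) (i : Fin 4) (q : E × E × ↥(ℝ ∙ e)ᗮ) :
    ‖Ψ e n i q‖ₑ ≤ ENNReal.ofReal (C ^ 3) *
      (wE q.2.1 * (wt q.1 q.2.1 (hhR e q.2.1 q.2.2) * env s q.1 q.2.1 (hhR e q.2.1 q.2.2))) := by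
  unfold Ψ
  rw [enorm_mul, enorm_mul, Real.enorm_eq_ofReal (by positivity),
    Real.enorm_eq_ofReal (wgt_nonneg _ _ _ _)]
  calc ENNReal.ofReal (2 * ‖q.2.1‖)⁻¹ * (ENNReal.ofReal (wgt i q.1 q.2.1 (hhR e q.2.1 q.2.2)) *
        ‖cubicForm n q.1 (q.1 + q.2.1) (q.1 + q.2.1 + hhR e q.2.1 q.2.2) (q.1 + hhR e q.2.1 q.2.2)‖ₑ)
      ≤ wE q.2.1 * (wt q.1 q.2.1 (hhR e q.2.1 q.2.2) *
          (ENNReal.ofReal (C ^ 3) * env s q.1 q.2.1 (hhR e q.2.1 q.2.2))) := by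
        gcongr
        · exact le_of_eq rfl
        · exact ofReal_wgt_le_wt _ _ _ _
        · exact h.enorm_cubicForm_le _ _ _
    _ = _ := by ring

/-- **Integrability of the weighted integrands** on `E × E × (ℝ∙e)ᗮ`. [folklore] -/
theorem integrable_Ψ (hF : FinHyp e s) (hn : Measurable n) (h : Decays C s n) (i : Fin 4) :
    Integrable (Ψ e n i) ((volume : Measure E).prod ((volume : Measure E).prod
      (volume : Measure ↥(ℝ ∙ e)ᗮ))) := by
  refine ⟨(measurable_Ψ hn i).aestronglyMeasurable, ?_⟩
  rw [hasFiniteIntegral_iff_enorm]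
  have hm : Meas3 (fun k a b : E => wt k a b * env s k a b) := by unfold Meas3 env; fun_prop
  calc ∫⁻ q, ‖Ψ e n i q‖ₑ ∂((volume : Measure E).prod ((volume : Measure E).prod
      (volume : Measure ↥(ℝ ∙ e)ᗮ)))
      ≤ ∫⁻ q, ENNReal.ofReal (C ^ 3) * (wE q.2.1 * (wt q.1 q.2.1 (hhR e q.2.1 q.2.2) *
          env s q.1 q.2.1 (hhR e q.2.1 q.2.2))) ∂((volume : Measure E).prod
            ((volume : Measure E).prod (volume : Measure ↥(ℝ ∙ e)ᗮ))) :=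
        lintegral_mono fun q => enorm_Ψ_le h i q
    _ = ENNReal.ofReal (C ^ 3) * N e (fun k a b : E => wt k a b * env s k a b) := by
        rw [lintegral_const_mul _ hm.integrand, N_eq_flat hm]
    _ < ∞ := ENNReal.mul_lt_top ENNReal.ofReal_lt_top hF.wt_env_fin

/-- Same in the `(a, c, k)` order. [folklore] -/
theorem integrable_Ψ' (hF : FinHyp e s) (hn : Measurable n) (h : Decays C s n) (i : Fin 4) :
    Integrable (fun q : E × ↥(ℝ ∙ e)ᗮ × E => Ψ e n i (q.2.2, q.1, q.2.1))
      ((volume : Measure E).prod ((volume : Measure ↥(ℝ ∙ e)ᗮ).prod (volume : Measure E))) := by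
  have hθ : MeasurePreserving (fun q : E × ↥(ℝ ∙ e)ᗮ × E => (q.2.2, q.1, q.2.1))
      ((volume : Measure E).prod ((volume : Measure ↥(ℝ ∙ e)ᗮ).prod (volume : Measure E)))
      ((volume : Measure E).prod ((volume : Measure E).prod (volume : Measure ↥(ℝ ∙ e)ᗮ))) := by
    have h1 := (measurePreserving_prodAssoc (volume : Measure E) (volume : Measure ↥(ℝ ∙ e)ᗮ)
      (volume : Measure E)).symm
    have h2 := Measure.measurePreserving_swap (μ := ((volume : Measure E).prod
      (volume : Measure ↥(ℝ ∙ e)ᗮ))) (ν := (volume : Measure E))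
    exact h2.comp h1
  exact (hθ.integrable_comp (measurable_Ψ hn i).aestronglyMeasurable).mpr (integrable_Ψ hF hn h i)

end Vanishing


section MainIdentity

variable {e : E} {s C : ℝ} {n : E → ℝ}

/-- `g i a ρ = ∫ k, wgtᵢ · cubicForm`. [folklore] -/
def gfun (n : E → ℝ) (i : Fin 4) (a ρ : E) : ℝ :=
  ∫ k, wgt i k a ρ * cubicForm n k (k + a) (k + a + ρ) (k + ρ)

/-- The `k`-integral of `Ψᵢ` is `(2‖a‖)⁻¹ gᵢ(a, hhR e a c)`. [folklore] -/
theorem integral_Ψ_k (n : E → ℝ) (i : Fin 4) (a : E) (c : ↥(ℝ ∙ e)ᗮ) :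
    ∫ k, Ψ e n i (k, a, c) = (2 * ‖a‖)⁻¹ * gfun n i a (hhR e a c) := by
  unfold Ψ gfun
  exact integral_const_mul ((2 * ‖a‖)⁻¹) _

/-- Change of variables `k ⇄ k₁` (translation `k ↦ k + a` and `cubicForm_swap01`): `g₁(-a, ρ) =
-g₀(a, ρ)`; no integrability needed. [cite: Nazarenko2011, §8.1.3 (8.18)–(8.21)] -/
theorem gfun_one (n : E → ℝ) (a ρ : E) : gfun n 1 (-a) ρ = -gfun n 0 a ρ := by
  unfold gfun
  simp only [wgt_one, wgt_zero]
  rw [← integral_add_right_eq_self _ a, ← integral_neg]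
  congr 1; funext k
  simp only [add_neg_cancel_right]
  rw [cubicForm_swap01 n k (k + a) (k + a + ρ) (k + ρ)]
  ring

/-- Change of variables `k ⇄ k₂` (translation `k ↦ k + a + ρ` and `cubicForm_swap02`): `g₂(-a, -ρ) =
g₀(a, ρ)`. [cite: Nazarenko2011, §8.1.3 (8.18)–(8.21)] -/
theorem gfun_two (n : E → ℝ) (a ρ : E) : gfun n 2 (-a) (-ρ) = gfun n 0 a ρ := by
  unfold gfun
  simp only [wgt_two, wgt_zero]
  rw [← integral_add_right_eq_self _ (a + ρ)]
  congr 1; funext k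
  rw [show k + (a + ρ) + -a + -ρ = k by abel, show k + (a + ρ) + -a = k + ρ by abel,
    show k + (a + ρ) + -ρ = k + a by abel, show k + (a + ρ) = k + a + ρ by abel,
    cubicForm_swap02 n k (k + a) (k + a + ρ) (k + ρ)]

/-- Change of variables `k ⇄ k₃` (translation `k ↦ k + ρ` and `cubicForm_swap03`): `g₃(a, -ρ) =
-g₀(a, ρ)`. [cite: Nazarenko2011, §8.1.3 (8.18)–(8.21)] -/
theorem gfun_three (n : E → ℝ) (a ρ : E) : gfun n 3 a (-ρ) = -gfun n 0 a ρ := by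
  unfold gfun
  simp only [wgt_three, wgt_zero]
  rw [← integral_add_right_eq_self _ ρ, ← integral_neg]
  congr 1; funext k
  rw [show k + ρ + a + -ρ = k + a by abel, show k + ρ + -ρ = k by abel,
    show k + ρ + a = k + a + ρ by abel, cubicForm_swap03 n k (k + a) (k + a + ρ) (k + ρ)]
  ring

/-- The nested integrals `Iᵢ = ∫ a, ∫ c, ∫ k, Ψᵢ`. [folklore] -/
def Inest (e : E) (n : E → ℝ) (i : Fin 4) : ℝ :=
  ∫ a, ∫ c : ↥(ℝ ∙ e)ᗮ, ∫ k, Ψ e n i (k, a, c)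

/-- `Iᵢ = ∫ (2‖a‖)⁻¹ ∫_{frame} gᵢ(a, ·)`. [folklore] -/
theorem Inest_eq (e : E) (n : E → ℝ) (i : Fin 4) :
    Inest e n i = ∫ a, (2 * ‖a‖)⁻¹ * ∫ c : ↥(ℝ ∙ e)ᗮ, gfun n i a (hhR e a c) := by
  unfold Inest
  congr 1; funext a
  simp_rw [integral_Ψ_k]
  exact integral_const_mul _ _

/-- `I₀ = -I₁` (uses `a ↦ -a` on `E` and `(ℝ ∙ (-a))ᗮ = (ℝ ∙ a)ᗮ`; no integrability needed). [cite:
Nazarenko2011, §8.1.3 (8.18)–(8.21)] -/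
theorem Inest_zero_one (he : ‖e‖ = 1) (n : E → ℝ) : Inest e n 0 = -Inest e n 1 := by
  rw [Inest_eq, Inest_eq, ← integral_w_frame_negA he (gfun n 1), ← integral_neg]
  congr 1; funext a
  rw [← mul_neg, ← integral_neg]
  congr 1; congr 1; funext c
  rw [gfun_one]; ring

/-- `I₀ = I₂` (uses `a ↦ -a`, `b ↦ -b`). [cite: Nazarenko2011, §8.1.3 (8.18)–(8.21)] -/
theorem Inest_zero_two (he : ‖e‖ = 1) (n : E → ℝ) : Inest e n 0 = Inest e n 2 := by
  rw [Inest_eq, Inest_eq, ← integral_w_frame_negA he (gfun n 2)]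
  congr 1; funext a
  rw [← integral_frame_negC e a (gfun n 2 (-a))]
  congr 1; congr 1; funext c
  exact (gfun_two n a _).symm

/-- `I₀ = -I₃` (uses `b ↦ -b` on the hyperplane). [cite: Nazarenko2011, §8.1.3 (8.18)–(8.21)] -/
theorem Inest_zero_three (n : E → ℝ) : Inest e n 0 = -Inest e n 3 := by
  rw [Inest_eq, Inest_eq, ← integral_neg]
  congr 1; funext a
  rw [← mul_neg, ← integral_neg, ← integral_frame_negC e a (fun ρ => -gfun n 3 a ρ)]
  congr 1; congr 1; funext c
  simp only [gfun_three, neg_neg]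

/-- Nested equals flat (order `(a, c, k)`). [folklore] -/
theorem Inest_eq_flat (hF : FinHyp e s) (hn : Measurable n) (hd : Decays C s n) (i : Fin 4) :
    Inest e n i = ∫ q : E × ↥(ℝ ∙ e)ᗮ × E, Ψ e n i (q.2.2, q.1, q.2.1)
      ∂((volume : Measure E).prod ((volume : Measure ↥(ℝ ∙ e)ᗮ).prod (volume : Measure E))) := by
  have hint := integrable_Ψ' hF hn hd i
  rw [integral_prod _ hint]
  unfold Inest
  refine integral_congr_ae ?_
  filter_upwards [hint.prod_right_ae] with a ha
  exact (integral_prod _ ha).symm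

omit [FiniteDimensional ℝ E] [MeasurableSpace E] [BorelSpace E] in
/-- On the resonant manifold the alternating weight vanishes: `‖k‖² - ‖k₁‖² + ‖k₂‖² - ‖k₃‖² = 2⟪a,
b⟫ = 0` for `b ⊥ a`, so `Ψ₀ - Ψ₁ + Ψ₂ - Ψ₃ = 0` pointwise (energy is a collision invariant,
Nazarenko's condition (8.19)). [cite: Nazarenko2011, §8.1.3 (8.18)–(8.21)] -/
theorem sum_Ψ_eq_zero (he : ‖e‖ = 1) (n : E → ℝ) (q : E × E × ↥(ℝ ∙ e)ᗮ) :
    Ψ e n 0 q - Ψ e n 1 q + Ψ e n 2 q - Ψ e n 3 q = 0 := by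
  obtain ⟨k, a, c⟩ := q
  unfold Ψ
  simp only [wgt_zero, wgt_one, wgt_two, wgt_three]
  set ρ := hhR e a (c : E)
  have hnorm : ‖k‖ ^ 2 - ‖k + a‖ ^ 2 + ‖k + a + ρ‖ ^ 2 - ‖k + ρ‖ ^ 2 = 2 * ⟪a, ρ⟫_ℝ := by
    have e1 := norm_add_sq_real (k + a) ρ
    have e2 := norm_add_sq_real k ρ
    rw [inner_add_left] at e1
    linarith
  by_cases ha : a = 0
  · subst ha; simp
  · have hinner : ⟪a, ρ⟫_ℝ = 0 := inner_hhR_of_mem he ha c.2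
    have : (2 * ‖a‖)⁻¹ * (‖k‖ ^ 2 * cubicForm n k (k + a) (k + a + ρ) (k + ρ))
        - (2 * ‖a‖)⁻¹ * (‖k + a‖ ^ 2 * cubicForm n k (k + a) (k + a + ρ) (k + ρ))
        + (2 * ‖a‖)⁻¹ * (‖k + a + ρ‖ ^ 2 * cubicForm n k (k + a) (k + a + ρ) (k + ρ))
        - (2 * ‖a‖)⁻¹ * (‖k + ρ‖ ^ 2 * cubicForm n k (k + a) (k + a + ρ) (k + ρ))
        = (2 * ‖a‖)⁻¹ * cubicForm n k (k + a) (k + a + ρ) (k + ρ) *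
          (‖k‖ ^ 2 - ‖k + a‖ ^ 2 + ‖k + a + ρ‖ ^ 2 - ‖k + ρ‖ ^ 2) := by ring
    rw [this, hnorm, hinner]
    ring

/-- `4 I₀ = I₀ - I₁ + I₂ - I₃ = ∫ (Ψ₀ - Ψ₁ + Ψ₂ - Ψ₃) = 0` (here Fubini and the finiteness of the
weighted envelopes enter). [cite: Nazarenko2011, §8.1.3 (8.18)–(8.21)] -/
theorem Inest_zero_eq_zero (hF : FinHyp e s) (hn : Measurable n) (hd : Decays C s n) :
    Inest e n 0 = 0 := by
  have h4 : 4 * Inest e n 0 = Inest e n 0 - Inest e n 1 + Inest e n 2 - Inest e n 3 := by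
    have := Inest_zero_one hF.he n; have := Inest_zero_two hF.he n
    have := Inest_zero_three (e := e) n
    linarith
  have hsum : Inest e n 0 - Inest e n 1 + Inest e n 2 - Inest e n 3 = 0 := by
    have h0 := integrable_Ψ' hF hn hd 0; have h1 := integrable_Ψ' hF hn hd 1
    have h2 := integrable_Ψ' hF hn hd 2; have h3 := integrable_Ψ' hF hn hd 3
    have hz : ∫ q : E × ↥(ℝ ∙ e)ᗮ × E, (Ψ e n 0 (q.2.2, q.1, q.2.1) - Ψ e n 1 (q.2.2, q.1, q.2.1)
        + Ψ e n 2 (q.2.2, q.1, q.2.1) - Ψ e n 3 (q.2.2, q.1, q.2.1))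
        ∂((volume : Measure E).prod ((volume : Measure ↥(ℝ ∙ e)ᗮ).prod (volume : Measure E)))
        = 0 := by
      simp only [sum_Ψ_eq_zero hF.he n, integral_zero]
    have e01 : ∫ q : E × ↥(ℝ ∙ e)ᗮ × E, (Ψ e n 0 (q.2.2, q.1, q.2.1) - Ψ e n 1 (q.2.2, q.1, q.2.1))
        ∂((volume : Measure E).prod ((volume : Measure ↥(ℝ ∙ e)ᗮ).prod (volume : Measure E)))
        = (∫ q : E × ↥(ℝ ∙ e)ᗮ × E, Ψ e n 0 (q.2.2, q.1, q.2.1)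
          ∂((volume : Measure E).prod ((volume : Measure ↥(ℝ ∙ e)ᗮ).prod (volume : Measure E))))
        - ∫ q : E × ↥(ℝ ∙ e)ᗮ × E, Ψ e n 1 (q.2.2, q.1, q.2.1)
          ∂((volume : Measure E).prod ((volume : Measure ↥(ℝ ∙ e)ᗮ).prod (volume : Measure E))) :=
      integral_sub h0 h1
    have e012 : ∫ q : E × ↥(ℝ ∙ e)ᗮ × E, (Ψ e n 0 (q.2.2, q.1, q.2.1) - Ψ e n 1 (q.2.2, q.1, q.2.1)
        + Ψ e n 2 (q.2.2, q.1, q.2.1))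
        ∂((volume : Measure E).prod ((volume : Measure ↥(ℝ ∙ e)ᗮ).prod (volume : Measure E)))
        = (∫ q : E × ↥(ℝ ∙ e)ᗮ × E, (Ψ e n 0 (q.2.2, q.1, q.2.1) - Ψ e n 1 (q.2.2, q.1, q.2.1))
          ∂((volume : Measure E).prod ((volume : Measure ↥(ℝ ∙ e)ᗮ).prod (volume : Measure E))))
        + ∫ q : E × ↥(ℝ ∙ e)ᗮ × E, Ψ e n 2 (q.2.2, q.1, q.2.1)
          ∂((volume : Measure E).prod ((volume : Measure ↥(ℝ ∙ e)ᗮ).prod (volume : Measure E))) :=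
      integral_add (h0.sub h1) h2
    have e0123 : ∫ q : E × ↥(ℝ ∙ e)ᗮ × E, (Ψ e n 0 (q.2.2, q.1, q.2.1) - Ψ e n 1 (q.2.2, q.1, q.2.1)
        + Ψ e n 2 (q.2.2, q.1, q.2.1) - Ψ e n 3 (q.2.2, q.1, q.2.1))
        ∂((volume : Measure E).prod ((volume : Measure ↥(ℝ ∙ e)ᗮ).prod (volume : Measure E)))
        = (∫ q : E × ↥(ℝ ∙ e)ᗮ × E, (Ψ e n 0 (q.2.2, q.1, q.2.1) - Ψ e n 1 (q.2.2, q.1, q.2.1)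
          + Ψ e n 2 (q.2.2, q.1, q.2.1))
          ∂((volume : Measure E).prod ((volume : Measure ↥(ℝ ∙ e)ᗮ).prod (volume : Measure E))))
        - ∫ q : E × ↥(ℝ ∙ e)ᗮ × E, Ψ e n 3 (q.2.2, q.1, q.2.1)
          ∂((volume : Measure E).prod ((volume : Measure ↥(ℝ ∙ e)ᗮ).prod (volume : Measure E))) :=
      integral_sub ((h0.sub h1).add h2) h3
    rw [Inest_eq_flat hF hn hd 0, Inest_eq_flat hF hn hd 1, Inest_eq_flat hF hn hd 2,
      Inest_eq_flat hF hn hd 3]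
    linarith
  linarith

/-- **Main identity**: the energy-weighted collision integral vanishes.
[cite: Nazarenko2011, §8.1.3 (8.18)–(8.21)] -/
theorem integral_normSq_mul_collision (hF : FinHyp e s) (hn : Measurable n) (hd : Decays C s n) :
    ∫ k, ‖k‖ ^ 2 * collision n k = 0 := by
  have hint := integrable_Ψ hF hn hd 0
  have step1 : ∀ k : E, ‖k‖ ^ 2 * collision n k = ∫ a, ∫ c : ↥(ℝ ∙ e)ᗮ, Ψ e n 0 (k, a, c) := by
    intro k
    rw [collision_frame hF.he n k, ← integral_const_mul]
    congr 1; funext a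
    rw [mul_left_comm, ← integral_const_mul, ← integral_const_mul]
    congr 1; funext c
    simp only [Ψ, wgt_zero]
  have step2 : ∀ᵐ k : E, ∫ a, ∫ c : ↥(ℝ ∙ e)ᗮ, Ψ e n 0 (k, a, c) =
      ∫ p : E × ↥(ℝ ∙ e)ᗮ, Ψ e n 0 (k, p) ∂((volume : Measure E).prod volume) := by
    filter_upwards [hint.prod_right_ae] with k hk
    exact (integral_prod _ hk).symm
  have hint' : Integrable (Function.uncurry fun (k : E) (p : E × ↥(ℝ ∙ e)ᗮ) => Ψ e n 0 (k, p))
      ((volume : Measure E).prod ((volume : Measure E).prod (volume : Measure ↥(ℝ ∙ e)ᗮ))) :=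
    hint
  have hint'' : Integrable (fun p : E × ↥(ℝ ∙ e)ᗮ => ∫ k, Ψ e n 0 (k, p))
      ((volume : Measure E).prod (volume : Measure ↥(ℝ ∙ e)ᗮ)) :=
    hint.swap.integral_prod_left
  simp_rw [step1]
  rw [integral_congr_ae step2, integral_integral_swap hint',
    integral_prod (fun p : E × ↥(ℝ ∙ e)ᗮ => ∫ k, Ψ e n 0 (k, p)) hint'']
  exact Inest_zero_eq_zero hF hn hd

end MainIdentity


/-! ### E. Time propagation: conservation of energy -/

section Energy

variable {e : E} {s C : ℝ}

/-- The `k`-dependent envelope of the collision integral (frame coordinates, product form).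
[folklore] -/
def Genv (e : E) (s : ℝ) (k : E) : ℝ≥0∞ :=
  ∫⁻ p : E × ↥(ℝ ∙ e)ᗮ, wE p.1 * env s k p.1 (hhR e p.1 p.2)
    ∂((volume : Measure E).prod (volume : Measure ↥(ℝ ∙ e)ᗮ))

/-- The envelope `env s` is jointly measurable. [folklore] -/
theorem meas3_env (s : ℝ) : Meas3 (env s : E → E → E → ℝ≥0∞) := by unfold Meas3 env; fun_prop

/-- `Genv` is measurable (Tonelli). [folklore] -/
theorem measurable_Genv (e : E) (s : ℝ) : Measurable (Genv e s) :=
  (meas3_env s).integrand.lintegral_prod_right'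

/-- Measurability of the `Genv` integrand at fixed `k`. [folklore] -/
theorem measurable_Genv_integrand (e : E) (s : ℝ) (k : E) :
    Measurable fun p : E × ↥(ℝ ∙ e)ᗮ => wE p.1 * env s k p.1 (hhR e p.1 p.2) :=
  (meas3_env s).integrand.comp measurable_prodMk_left

/-- `Genv` as a nested integral `∫⁻ a, (2‖a‖)⁻¹ ∫⁻ c, env`. [folklore] -/
theorem Genv_eq_nested (e : E) (s : ℝ) (k : E) :
    Genv e s k = ∫⁻ a, wE a * ∫⁻ c : ↥(ℝ ∙ e)ᗮ, env s k a (hhR e a c) := by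
  unfold Genv
  rw [lintegral_prod _ (measurable_Genv_integrand e s k).aemeasurable]
  refine lintegral_congr fun a => ?_
  exact lintegral_const_mul' _ _ (wE_ne_top a)

/-- `∫⁻ ‖k‖² G(k) dk ≤ N (wt · env) < ∞`. [folklore] -/
theorem lintegral_normSq_Genv_lt_top (hF : FinHyp e s) :
    ∫⁻ k, ENNReal.ofReal (‖k‖ ^ 2) * Genv e s k < ∞ := by
  have hm : Meas3 (fun k a b : E => ENNReal.ofReal (‖k‖ ^ 2) * env s k a b) := by
    unfold Meas3 env; fun_prop
  have h1 : ∫⁻ k, ENNReal.ofReal (‖k‖ ^ 2) * Genv e s k =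
      N e (fun k a b : E => ENNReal.ofReal (‖k‖ ^ 2) * env s k a b) := by
    unfold N Genv
    refine lintegral_congr fun k => ?_
    rw [lintegral_prod _ (measurable_Genv_integrand e s k).aemeasurable,
      ← lintegral_const_mul' _ _ ENNReal.ofReal_ne_top]
    refine lintegral_congr fun a => ?_
    rw [← lintegral_const_mul' _ _ ENNReal.ofReal_ne_top]
    refine lintegral_congr fun c => ?_
    simp only
    ring
  rw [h1]
  refine lt_of_le_of_lt (N_mono fun k a b => ?_) hF.wt_env_fin
  gcongr
  unfold wt
  exact le_add_right (le_add_right le_self_add)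

/-- **Collision bound**: `‖𝒦(n)(k)‖ₑ ≤ C³ G(k)`. [folklore] -/
theorem enorm_collision_le (he : ‖e‖ = 1) {n : E → ℝ} (hd : Decays C s n) (k : E) :
    ‖collision n k‖ₑ ≤ ENNReal.ofReal (C ^ 3) * Genv e s k := by
  rw [collision_frame he n k, Genv_eq_nested]
  refine (enorm_integral_le_lintegral_enorm _).trans ?_
  rw [← lintegral_const_mul' _ _ ENNReal.ofReal_ne_top]
  refine lintegral_mono fun a => ?_
  rw [enorm_mul, Real.enorm_eq_ofReal (by positivity : (0 : ℝ) ≤ (2 * ‖a‖)⁻¹)]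
  change wE a * _ ≤ _
  rw [mul_left_comm]
  gcongr
  refine (enorm_integral_le_lintegral_enorm _).trans ?_
  rw [← lintegral_const_mul' _ _ ENNReal.ofReal_ne_top]
  exact lintegral_mono fun c => hd.enorm_cubicForm_le k a _

omit [InnerProductSpace ℝ E] [FiniteDimensional ℝ E] [MeasurableSpace E] [BorelSpace E] in
/-- `‖x‖² (1 + ‖x‖)^{-s} ≤ (1 + ‖x‖)^{-(s-2)}` (real version). [folklore] -/
theorem normSq_mul_jr_le (s : ℝ) (x : E) : ‖x‖ ^ 2 * jr s x ≤ jr (s - 2) x := by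
  unfold jr
  have h1 : 0 < 1 + ‖x‖ := by positivity
  have : (1 + ‖x‖) ^ (-(s - 2)) = (1 + ‖x‖) ^ (2 : ℝ) * (1 + ‖x‖) ^ (-s) := by
    rw [← Real.rpow_add h1]; ring_nf
  rw [this, Real.rpow_two]
  gcongr
  linarith [norm_nonneg x]

/-- Integrability of the energy density `‖k‖² n(k)` under decay of order `s > dim E + 2`.
[folklore] -/
theorem integrable_normSq_mul (hs : (Module.finrank ℝ E : ℝ) + 2 < s) {n : E → ℝ}
    (hn : Measurable n) (hd : Decays C s n) : Integrable (fun k : E => ‖k‖ ^ 2 * n k) := by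
  have hint : Integrable (fun k : E => C * jr (s - 2) k) :=
    (integrable_one_add_norm (by linarith)).const_mul C
  refine hint.mono' (by fun_prop : Measurable fun k : E => ‖k‖ ^ 2 * n k).aestronglyMeasurable
    (Filter.Eventually.of_forall fun k => ?_)
  rw [norm_mul, norm_pow, norm_norm, Real.norm_eq_abs]
  calc ‖k‖ ^ 2 * |n k| ≤ ‖k‖ ^ 2 * (C * jr s k) := by gcongr; exact hd k
    _ = C * (‖k‖ ^ 2 * jr s k) := by ring
    _ ≤ C * jr (s - 2) k := by gcongr; exacts [hd.C_nonneg, normSq_mul_jr_le s k]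

end Energy

end EnergyConservation

open EnergyConservation in
/-- **Conservation of energy for the wave kinetic equation** (discharge of
`IsWKESolutionOn.energy_conserved`): for a classical solution `n` of `∂ₜ n = 𝒦(n)` on `[0, T)` in
dimension `≥ 3` with `|n(t, k)| ≤ C ⟨k⟩^{-s}`, `s > dim E + 2`, the energy `∫ |k|² n(t, k) dk` is
constant in `t ∈ [0, T)`.

Proof: Nazarenko's symmetrisation argument [cite: Nazarenko2011, §8.1.3 (8.18)–(8.21)] made
rigorous: the resonant measure `dk da (2‖a‖)⁻¹ dσ_{a^⊥}(b)` is invariant under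
`(k, k₁, k₂, k₃) ↦ (k₂, k₃, k, k₁)` (`N_symm`), the weighted envelope integrals are finite for
`s > dim E + 2` (`FinHyp.wt_env_fin`), whence Fubini applies and
`∫ |k|² 𝒦(n)(k) dk = ¼ ∫ (|k|² − |k₁|² + |k₂|² − |k₃|²) ⋯ = ¼ ∫ 2⟨a, b⟩ ⋯ = 0`
(`integral_normSq_mul_collision`); then `t ↦ ∫ |k|² n(t, k) dk` is continuous with vanishing
right derivative (dominated convergence, mean value inequality), hence constant
(`constant_of_has_deriv_right_zero`). -/
theorem IsWKESolutionOn.energy_conserved_holds : IsWKESolutionOn.energy_conserved (E := E) := by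
  intro T s n hn hE hs hdecay hmeas t ht
  -- a unit vector and the standing hypotheses
  obtain ⟨x, hx⟩ := (Module.finrank_pos_iff_exists_ne_zero (R := ℝ) (M := E)).mp (by omega)
  set e : E := ‖x‖⁻¹ • x with he_def
  have he : ‖e‖ = 1 := by
    rw [he_def, norm_smul, norm_inv, norm_norm, inv_mul_cancel₀ (norm_ne_zero_iff.mpr hx)]
  have hF : EnergyConservation.FinHyp e s := ⟨he, by omega, hs⟩
  obtain ⟨C, hC⟩ := hdecay
  have hd : ∀ τ ∈ Ico (0 : ℝ) T, EnergyConservation.Decays C s (n τ) := fun τ hτ k => hC τ hτ k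
  -- the energy functional
  set φ : ℝ → ℝ := fun τ => ∫ k, ‖k‖ ^ 2 * n τ k with hφ
  -- E6: continuity on `[0, T)`
  have hcont : ContinuousOn φ (Ico 0 T) := by
    have hCpos : 0 ≤ C ∨ Ico (0 : ℝ) T = ∅ := by
      rcases (Ico (0 : ℝ) T).eq_empty_or_nonempty with h | ⟨τ, hτ⟩
      · exact Or.inr h
      · exact Or.inl (hd τ hτ).C_nonneg
    refine continuousOn_of_dominated (bound := fun k : E => C * EnergyConservation.jr (s - 2) k) ?_ ?_ ?_ ?_
    · intro τ hτ
      exact ((measurable_norm.pow_const 2).mul (hmeas τ hτ)).aestronglyMeasurable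
    · intro τ hτ
      refine Filter.Eventually.of_forall fun k => ?_
      rw [norm_mul, norm_pow, norm_norm, Real.norm_eq_abs]
      calc ‖k‖ ^ 2 * |n τ k| ≤ ‖k‖ ^ 2 * (C * EnergyConservation.jr s k) := by gcongr; exact hd τ hτ k
        _ = C * (‖k‖ ^ 2 * EnergyConservation.jr s k) := by ring
        _ ≤ C * EnergyConservation.jr (s - 2) k := by
            gcongr; exacts [(hd τ hτ).C_nonneg, EnergyConservation.normSq_mul_jr_le s k]
    · exact (integrable_one_add_norm (by linarith)).const_mul C
    · refine Filter.Eventually.of_forall fun k => ?_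
      exact (continuousOn_const.mul (hn k).1)
  -- E5: vanishing right derivative
  have hderiv : ∀ τ ∈ Ico (0 : ℝ) T, HasDerivWithinAt φ 0 (Ici τ) τ := by
    intro τ hτ
    have hGfin : ∫⁻ k, ENNReal.ofReal (‖k‖ ^ 2) * EnergyConservation.Genv e s k < ∞ := EnergyConservation.lintegral_normSq_Genv_lt_top hF
    -- the dominating function
    set bound : E → ℝ := fun k =>
      (ENNReal.ofReal (C ^ 3) * (ENNReal.ofReal (‖k‖ ^ 2) * EnergyConservation.Genv e s k)).toReal with hbound
    have hmeasG : Measurable fun k : E => ENNReal.ofReal (‖k‖ ^ 2) * EnergyConservation.Genv e s k :=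
      (by fun_prop : Measurable fun k : E => ENNReal.ofReal (‖k‖ ^ 2)).mul (EnergyConservation.measurable_Genv e s)
    have hbound_int : Integrable bound := by
      refine integrable_toReal_of_lintegral_ne_top (hmeasG.const_mul _).aemeasurable ?_
      rw [lintegral_const_mul _ hmeasG]
      exact (ENNReal.mul_lt_top ENNReal.ofReal_lt_top hGfin).ne
    -- a.e. finiteness of `G`
    have hae : ∀ᵐ k : E, EnergyConservation.Genv e s k < ∞ := by
      have h1 : ∀ᵐ k : E, ENNReal.ofReal (‖k‖ ^ 2) * EnergyConservation.Genv e s k < ∞ := ae_lt_top hmeasG hGfin.ne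
      have h2 : ∀ᵐ k : E, k ≠ 0 := by
        haveI : Nontrivial E := Module.nontrivial_of_finrank_pos (R := ℝ) (by omega)
        exact compl_mem_ae_iff.mpr (measure_singleton (0 : E))
      filter_upwards [h1, h2] with k hk hk0
      by_contra htop
      rw [not_lt, top_le_iff] at htop
      rw [htop, ENNReal.mul_top (by simpa using hk0)] at hk
      exact lt_irrefl _ hk
    -- mean value bound, for a.e. `k`
    have hmvt : ∀ h ∈ Ioo τ T, ∀ᵐ k : E, ‖n h k - n τ k‖ ≤
        (ENNReal.ofReal (C ^ 3) * EnergyConservation.Genv e s k).toReal * (h - τ) := by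
      intro h hh
      filter_upwards [hae] with k hk
      have hfin : ENNReal.ofReal (C ^ 3) * EnergyConservation.Genv e s k ≠ ∞ :=
        ENNReal.mul_ne_top ENNReal.ofReal_ne_top hk.ne
      refine norm_image_sub_le_of_norm_deriv_right_le_segment (f := fun σ => n σ k)
        (f' := fun σ => collision (n σ) k) ?_ ?_ ?_ h (right_mem_Icc.mpr hh.1.le)
      · exact (hn k).1.mono (Icc_subset_Ico_right hh.2 |>.trans (Ico_subset_Ico_left hτ.1))
      · intro σ hσ
        exact ((hn k).2 σ ⟨hτ.1.trans hσ.1, hσ.2.trans hh.2⟩).2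
      · intro σ hσ
        have hσ' : σ ∈ Ico (0 : ℝ) T := ⟨hτ.1.trans hσ.1, hσ.2.trans hh.2⟩
        have hle := EnergyConservation.enorm_collision_le (e := e) he (hd σ hσ') k
        rw [← toReal_enorm]
        exact ENNReal.toReal_mono hfin hle
    have hτT : τ < T := hτ.2
    have hintτ : ∀ σ ∈ Ico (0 : ℝ) T, Integrable (fun k : E => ‖k‖ ^ 2 * n σ k) := fun σ hσ =>
      EnergyConservation.integrable_normSq_mul hs (hmeas σ hσ) (hd σ hσ)
    -- the difference quotients
    set F : ℝ → E → ℝ := fun h k => (h - τ)⁻¹ * (‖k‖ ^ 2 * n h k - ‖k‖ ^ 2 * n τ k) with hFdef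
    have hlim : Tendsto (fun h => ∫ k, F h k) (𝓝[>] τ)
        (𝓝 (∫ k, ‖k‖ ^ 2 * collision (n τ) k)) := by
      refine tendsto_integral_filter_of_dominated_convergence bound ?_ ?_ hbound_int ?_
      · filter_upwards [Ioo_mem_nhdsGT hτT] with h hh
        have hh' : h ∈ Ico (0 : ℝ) T := ⟨hτ.1.trans hh.1.le, hh.2⟩
        exact ((((measurable_norm.pow_const 2).mul (hmeas h hh')).sub
          ((measurable_norm.pow_const 2).mul (hmeas τ hτ))).const_mul _).aestronglyMeasurable
      · filter_upwards [Ioo_mem_nhdsGT hτT] with h hh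
        filter_upwards [hmvt h hh] with k hk
        have hpos : 0 < h - τ := sub_pos.mpr hh.1
        have eq1 : F h k = (h - τ)⁻¹ * (‖k‖ ^ 2 * (n h k - n τ k)) := by
          simp only [hFdef]; ring
        rw [eq1, norm_mul, norm_mul, norm_inv, Real.norm_of_nonneg hpos.le, norm_pow, norm_norm]
        calc (h - τ)⁻¹ * (‖k‖ ^ 2 * ‖n h k - n τ k‖)
            ≤ (h - τ)⁻¹ * (‖k‖ ^ 2 * ((ENNReal.ofReal (C ^ 3) * EnergyConservation.Genv e s k).toReal * (h - τ))) := by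
              gcongr
          _ = ‖k‖ ^ 2 * (ENNReal.ofReal (C ^ 3) * EnergyConservation.Genv e s k).toReal := by
              field_simp
          _ = bound k := by
              simp only [hbound, ENNReal.toReal_mul, ENNReal.toReal_ofReal (sq_nonneg _)]
              ring
      · refine Filter.Eventually.of_forall fun k => ?_
        have hdk : HasDerivWithinAt (fun σ => n σ k) (collision (n τ) k) (Ioi τ) τ :=
          (((hn k).2 τ hτ).2).mono Ioi_subset_Ici_self
        rw [hasDerivWithinAt_iff_tendsto_slope' (show τ ∉ Ioi τ by simp)] at hdk
        have := hdk.const_mul (‖k‖ ^ 2)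
        refine this.congr fun h => ?_
        rw [slope_def_module, smul_eq_mul, hFdef]
        ring
    have hslope : ∀ h ∈ Ioo τ T, slope φ τ h = ∫ k, F h k := by
      intro h hh
      have hh' : h ∈ Ico (0 : ℝ) T := ⟨hτ.1.trans hh.1.le, hh.2⟩
      rw [slope_def_module, smul_eq_mul, hφ, hFdef]
      simp only
      rw [integral_const_mul, integral_sub (hintτ h hh') (hintτ τ hτ)]
    have hmain : ∫ k, ‖k‖ ^ 2 * collision (n τ) k = 0 :=
      EnergyConservation.integral_normSq_mul_collision hF (hmeas τ hτ) (hd τ hτ)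
    rw [hmain] at hlim
    have hsl : Tendsto (slope φ τ) (𝓝[>] τ) (𝓝 0) := by
      refine hlim.congr' ?_
      filter_upwards [Ioo_mem_nhdsGT hτT] with h hh
      exact (hslope h hh).symm
    rw [← hasDerivWithinAt_Ioi_iff_Ici, hasDerivWithinAt_iff_tendsto_slope' (show τ ∉ Ioi τ by simp)]
    exact hsl
  -- E7: conclude
  have hcont' : ContinuousOn φ (Icc 0 t) := hcont.mono (Icc_subset_Ico_right ht.2)
  have := constant_of_has_deriv_right_zero hcont'
    (fun x hx => hderiv x ⟨hx.1, hx.2.trans ht.2⟩) t (right_mem_Icc.mpr ht.1)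
  exact this

end WaveKinetic
end
end Literature.Analysis.FluidPDE
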